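import Summits.FinalStateConjecture.FinalStateConjecture.Theses.EIHFluxBalance
import Summits.FinalStateConjecture.FinalStateConjecture.Theorems.EIHFluxBalanceInertialRecessionStubPseudotensorBound
import Summits.FinalStateConjecture.FinalStateConjecture.Theorems.EIHFluxBalanceInertialRecessionStubChargeModelWindowLawMain
import Summits.FinalStateConjecture.FinalStateConjecture.Theorems.EIHFluxBalanceInertialRecessionStubEndgameOracleTop
import Summits.FinalStateConjecture.FinalStateConjecture.Theorems.EIHFluxBalanceInertialRecessionStubIdentificationMain
import Summits.FinalStateConjecture.FinalStateConjecture.Theorems.EIHFluxBalanceInertialRecessionStubCleanExcision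
import Summits.FinalStateConjecture.FinalStateConjecture.Theorems.EIHFluxBalanceInertialRecessionStubOracleOfClusterBalance
import Summits.FinalStateConjecture.FinalStateConjecture.Theorems.EIHFluxBalanceInertialRecessionStubNoHolesOnRegion
import Summits.FinalStateConjecture.FinalStateConjecture.Theorems.EIHFluxBalanceInertialRecessionStubRechart12OnRegion
import Summits.FinalStateConjecture.FinalStateConjecture.Theorems.EIHFluxBalanceInertialRecessionStaircaseBalance
import Summits.FinalStateConjecture.FinalStateConjecture.Theorems.EIHFluxBalanceInertialRecessionStubSlaving12Reduction
import Summits.FinalStateConjecture.FinalStateConjecture.Theorems.EIHFluxBalanceInertialRecessionStubSlaving12RelRicciC3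
import Summits.FinalStateConjecture.FinalStateConjecture.Theorems.EIHFluxBalanceInertialRecessionStubMomRowLinear
import Summits.FinalStateConjecture.FinalStateConjecture.Theorems.EIHFluxBalanceInertialRecessionStubMomCapstone
import Summits.FinalStateConjecture.FinalStateConjecture.Theorems.EIHFluxBalanceInertialRecessionStubCoerMomQuant
import Summits.FinalStateConjecture.FinalStateConjecture.Theorems.EIHFluxBalanceInertialRecessionStubCoerSymbolQuant
import Summits.FinalStateConjecture.FinalStateConjecture.Theorems.EIHFluxBalanceInertialRecessionStubFirstOrderSlaving
import Summits.FinalStateConjecture.FinalStateConjecture.Theorems.EIHFluxBalanceInertialRecessionStubCoerMomKernelAssembly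
import Summits.FinalStateConjecture.FinalStateConjecture.Theorems.EIHFluxBalanceInertialRecessionStubHigherOrderSlaving

/-!
# Line `SketchCleanExcision` (idea `clean-excision-has-a-rate`) — skeleton r13 (r12 + linear slaving re-cut) for the RESTATED crux
# `InertialRecession` (E′, item stmt-FinalStateConjecture-17403, route `EIHFluxBalance`)

Lead: `prover-line-stmt-FinalStateConjecture-17403-0` (gen 1, 2026-08-17). Card: `Cruxes/InertialRecession/Ideas/clean-excision-has-a-rate.md`;
sketch: `Cruxes/InertialRecession/SketchCleanExcision.lean`; predecessor skeleton (old decl, stmt-…-10166): r11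
`Cruxes/InertialRecession/Lines/sublinear_is_free_clean_window_charges.lean` (leads r2–r11), whose landed `--supports` material this
skeleton re-uses by name (pseudotensor bound p91215, window law p93132, identification p122003, oracle ⇒ velocities `…OracleTop`).

## What changed against r11 (E → E′, REPAIR rev 6)

The restated crux E′ APPENDS four clauses to the antecedent — (T) eventual lab-time causality on the guaranteed late region, (O) orthochronous
painted frames, (R) `RaysStayInClosure 𝒟 O` for the lab chart's own `O`, (QS) weighted quasi-stationarity of the painted background — and
concludes the re-typed summit clause (`… ∧ RaysStayInClosure 𝒟 O′ ∧ HasExhaustiveCharts d ∧ IsFutureOriented d`, honest radii). Hence: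
* r11's `stub_labChartCausalRigidity` ((T)+(O)) and `stub_weightedQuasiStationarity` (QS) are now HYPOTHESES — deleted;
* r11's `stub_rechart` is re-cut ON THE GIVEN REGION: `stub_rechartOnRegion` concludes `∃ d : FinalStateDecomposition 𝒟 O 2` on the lab
  chart's own `O` (with `O = exteriorOf 𝒟 d.charted`, honest-radii exhaustion and `IsFutureOriented d`), so (R) passes through the
  composition verbatim (design of the landed `Theorems.…StubRechart11Region.exists_finalStateDecomposition_onRegion_of_rechart`); it takes
  (T) and (O) as hypotheses (both in the antecedent now) and `0 < N`;
* `N = 0` is re-cut the same way: `stub_noHolesOnRegion` (the landed `Theorems.inertialRecession_noHoles` proves the OLD conclusion on the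
  smaller region `J⁺(ιX) ∩ I⁻(Φ{x⁰ > τ₀+1})`; on-region needs exhaustion at `τ₀ + 2` + push-up `J⁻(open) = I⁻(open)`, and orientation (iii) of
  the flat chart `Φ` from (T));
* THE LINE: r11's open Mathlib stub `stub_incrementOracle` (K2b; general member sets needed a re-partition count bounded in `N` because the
  identification slack `ζ` has no rate) is REPLACED by the clean-excision triple — `stub_cleanExcision` (GR: equal-time excision identity
  with a rate in SCALE, `|P(big window) − Σ P(sub-windows)| ≤ C·Rm^{-1/2}`, hypotheses verbatim those of the proved identification;
  corollary of the landed `LLGauss.perforatedGauss_law`, `shellGaussLaw_vacuum`, `abs_emComplex_le_of_pseudotensorBound`,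
  `ll_bulk_decay_bound`, `lab_sphereConditions`), `stub_integratedClusterBalance` (Mathlib: WINDOW LAW + IDENTIFICATION + (EXC) ⇒ the
  integrated cluster balance `‖Δ_{[t₁,t₂]} Σ_S Mγ(1,v)‖ ≤ ζ₀(t₁) + C₀∫ min(r,s)^{-3/2}` for EVERY member set `S` isolated by set-distance
  `r(s)` — staircase of static covers at a gap scale, re-covering paid by (EXC) as a Riemann sum of the flux integrand, identification paid
  only at the two ends) and `stub_oracleOfClusterBalance` (Mathlib: the r11 ORACLE(Q) conclusion verbatim from the cluster balance —
  ballistic outsiders give `r(s) ≥ max(A₀, (W/2)|s − s_{ij}|)`, the landed `integral_radius_le(_mixed)`; slowness of `S` unused);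
* `stub_slaving` (K1) is r11's, byte-identical.
Stubs: 7 declared; landed so far (cited without `sorry`): `stub_pseudotensorBound` (p91215), `stub_cleanExcision` (p134015),
`stub_oracleOfClusterBalance` (p134034), `stub_noHolesOnRegion` (p134159), `stub_rechartOnRegion` (p135865, + helpers …StubRechart12*),
`stub_integratedClusterBalance` (p136021; staircase parts …Staircase{Gap,Scales,Cover,Step,Facts,Main,Bound,Balance}); open: `stub_slaving` ONLY.
Composition `InertialRecession_of` concludes E′ BY NAME. The Theses-free closing file (route-decl body verbatim) is the lead's `work/Closing.template.lean`.

## r13 (lead c1-0, 2026-08-17): the slaving stub re-cut along the LINEAR architecture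
`stub_relRicciSlaving` (r12c) is retired (nonlinear gap at the first order); `stub_frozenVacuumSlaving` is PROVED from seven
registered stubs — ML `stub_momRowLinear` (Codazzi shadow: momentum rows linear in the normal first jet), A `stub_momCapstone`
(linear relative momentum bound from frozen-vacuum data), Bk `stub_coerMomKernel` (COER-mom kernel, all boosts and spins),
Bs `stub_coerMomQuant` (quantitative uniform robust COER-mom by compactness), C `stub_coerSymbolQuant` (quantitative COER-B
from the landed symbol/first-variation kernels), D `stub_firstOrderSlaving` (J¹ → 0 by linear absorption), EF
`stub_higherOrderSlaving` (J², J³ → 0, soft) — plus the landed `exists_relRicci_of_frozenVacuum`. Design memo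
`Cruxes/InertialRecession/Lines/SketchCleanExcision.md`.

## Disproof.lean obligations (gens 1–3, written against the old decl; re-read 2026-08-17)

§C/§G (`inertialRecession_false_without_fieldEquations[_cesaro]`): the field equations enter through `𝒟` in `stub_slaving`,
`stub_cleanExcision` (bulk `= (−g)t_LL` only where `Ric(Φ^*g) = 0`) and the landed window law / identification; the Mathlib stubs derive
nothing from kinematics alone (their charges are hypotheses the §C witness violates). §D/§H: exponent `3/2 > 1` at the SET-isolation
scale; no per-hole momentum below its isolation scale is claimed. `Negative/ExpandingChargeAdditivity` (additivity load-bearing): (EXC) is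
additivity made quantitative. `Negative/PaintingRigidityStabiliser`: no stub bounds `deriv Λᵢ`. No `-- Targets` theorem of Disproof.lean
names a stub of this skeleton (the file predates E′).
-/

set_option linter.dupNamespace false
set_option maxSynthPendingDepth 6
set_option synthInstance.maxHeartbeats 200000

noncomputable section

namespace Summit.FinalStateConjecture.FinalStateConjecture.Cruxes.InertialRecession.SketchCleanExcision

open scoped BigOperators Topology Manifold Classical MeasureTheory Matrix InnerProductSpace ContDiff ENNReal
open Filter Set Function TopologicalSpace MeasureTheory Literature.Geometry.Lorentzian
open Summit.FinalStateConjecture.FinalStateConjecture.Theses.EIHFluxBalance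

/-! ## The stubs (registered; every signature self-contained)

Reshape r13 (lead c1-0, 2026-08-17): the r12c stub `stub_relRicciSlaving` (RRS) is RETIRED — its only
first-order information is the `λ²`-relative Ricci bound, which leaves the nonlinear gap
`c|J¹| ≤ Cε(1 + |J¹|²)` (seat 0 RRS_branch_note.md, seat 1 K1_RRS_vs_FVS_cut.md). FROZEN-VACUUM SLAVING
(`stub_frozenVacuumSlaving`, registered r12b, the hypothesis of the landed reduction
`stub_slaving_of_frozenVacuumSlaving`) is now PROVED below from seven registered stubs along the LINEAR
(momentum-constraint) architecture: the momentum rows `Ric(G)(♯_G dx⁰, e_j)` of any metric are the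
Codazzi/momentum constraint, exactly affine in the normal first jet (ML); so the rows of the modulated ansatz
are exactly linear in the first jet `J¹`, a linear relative bound (A: `|rows(g₀)| ≤ ε(1 + ‖Dg₀‖ + ‖D_sp Dg₀‖)`
from `Ric(g₀ + e) = 0`) and a linear injectivity (Bk/Bs: COER-mom, every boost and spin) give `J¹ → 0` by
linear absorption (D); then `J², J³ → 0` from the landed jet-relative `C²`/`C³` bound
(`exists_relRicci_of_frozenVacuum`) and the principal-symbol coercivity (C: symbol kernel + first-variation
kernel, both landed qualitatively) by Lipschitz bounds on compact jet sets (EF). Design memo: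
`Cruxes/InertialRecession/Lines/SketchCleanExcision.md` (r13). Objects (tree vocabulary only): one painted
summand with centre event `0`, `K = boostedKerrBilin L 0 M a`; an infinitesimal Poincaré motion of the REST
frame `(A, d)`, `A` `η`-skew (along a motion `A = (d/ds Λ⁻¹) ∘ Λ`, `d = −Λ⁻¹ ċ`); its lab first-variation field
`Var z = (∂_{Ay+d} g_{M,a})(y)(Λ⁻¹·,Λ⁻¹·) + g_{M,a}(y)(AΛ⁻¹·,Λ⁻¹·) + g_{M,a}(y)(Λ⁻¹·,AΛ⁻¹·)`, `y = Λ⁻¹z`; the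
first-order model `z ↦ G z + z⁰ • Var z` (same slice values, normal first jet shifted by `Var`); the reduced size
`‖A e₀‖ + ‖d⃗‖ + ‖a • A e₃‖` (the axial rotation rate and `d⁰` are the Kerr–Schild stabiliser). -/

/-- **ML · MOMENTUM ROWS ARE LINEAR IN THE NORMAL FIRST JET** ("Codazzi shadow", `MetricCoord` on `E4`).
Two metric fields with the same value at `x` whose jets differ along a covector `n` by `(A, P, W)`
(`DG₁ = DG + n ⊗ A`, `D²G₁(v) = D²G(v) + n(v)P + n ⊗ P(v) + n(v) n ⊗ W`): the rows
`Ric(G₁)(♯_G n, e) − Ric(G)(♯_G n, e)`, `n(e) = 0`, are (i) LINEAR in `(A, P)` (and independent of `W` —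
landed `ricAt_sharp_ker_eq_of_jet₂_along`, …COERMomSlot) and (ii) bounded by
`C(μ,ν) (1 + ‖DG(x)‖)(‖A‖ + ‖P‖)‖n‖²‖e‖` when `G(x)` is `μ`-coercive with `‖G(x)‖ ≤ ν`. Mechanism: the
`A`-quadratic terms of the exact curvature difference `riemAt_apply_eq_add_of_jet₁` (…COERMomSlot) cancel in
the `(♯n, ker n)` trace — in ADM language `Ric(♯dx⁰, e_j) = −(1/N)(D_iK^i_j − D_j tr K)` is linear in `K`.
Consumed by A, Bs, D. Size M. [cite: ONeill1983, Ch. 4, Prop. 4.33 (Codazzi equation)] -/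
theorem stub_momRowLinear :
    (∀ {G G₁ G₂ G₃ : E4 → E4 →L[ℝ] E4 →L[ℝ] ℝ} {V : Set E4} {x : E4} {n : E4 →L[ℝ] ℝ} {A₁ A₂ : E4 →L[ℝ] E4 →L[ℝ] ℝ} {P₁ P₂ : E4 →L[ℝ] E4 →L[ℝ] E4 →L[ℝ] ℝ} {W₁ W₂ W₃ : E4 →L[ℝ] E4 →L[ℝ] ℝ} (c₁ c₂ : ℝ), MetricCoord.IsMetricOn G V → MetricCoord.IsMetricOn G₁ V → MetricCoord.IsMetricOn G₂ V → MetricCoord.IsMetricOn G₃ V → x ∈ V → G₁ x = G x → G₂ x = G x → G₃ x = G x → fderiv ℝ G₁ x = fderiv ℝ G x + n.smulRight A₁ → fderiv ℝ G₂ x = fderiv ℝ G x + n.smulRight A₂ → fderiv ℝ G₃ x = fderiv ℝ G x + n.smulRight (c₁ • A₁ + c₂ • A₂) → (∀ v, fderiv ℝ (fderiv ℝ G₁) x v = fderiv ℝ (fderiv ℝ G) x v + (n v • P₁ + n.smulRight (P₁ v) + n v • n.smulRight W₁)) → (∀ v, fderiv ℝ (fderiv ℝ G₂) x v = fderiv ℝ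 (fderiv ℝ G) x v + (n v • P₂ + n.smulRight (P₂ v) + n v • n.smulRight W₂)) → (∀ v, fderiv ℝ (fderiv ℝ G₃) x v = fderiv ℝ (fderiv ℝ G) x v + (n v • (c₁ • P₁ + c₂ • P₂) + n.smulRight ((c₁ • P₁ + c₂ • P₂) v) + n v • n.smulRight W₃)) → ∀ e : E4, n e = 0 → MetricCoord.ricAt G₃ x (MetricCoord.sharpAt G x n) e - MetricCoord.ricAt G x (MetricCoord.sharpAt G x n) e = c₁ * (MetricCoord.ricAt G₁ x (MetricCoord.sharpAt G x n) e - MetricCoord.ricAt G x (MetricCoord.sharpAt G x n) e) + c₂ * (MetricCoord.ricAt G₂ x (MetricCoord.sharpAt G x n) e - MetricCoord.ricAt G x (MetricCoord.sharpAt G x n) e)) ∧ (∀ μ ν : ℝ, 0 < μ → ∃ C : ℝ, ∀ {G G₁ : E4 → E4 →L[ℝ] E4 →L[ℝ] ℝ} {V : Set E4} {x : E4} {n : E4 →L[ℝ] ℝ} {A : E4 →L[ℝ] E4 →L[ℝ] ℝ} {P : E4 →L[ℝ] E4 →L[ℝ] E4 →L[ℝ] ℝ} {W : E4 →L[ℝ]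 E4 →L[ℝ] ℝ}, MetricCoord.IsMetricOn G V → MetricCoord.IsMetricOn G₁ V → x ∈ V → (∀ v : E4, μ * ‖v‖ ≤ ‖G x v‖) → ‖G x‖ ≤ ν → G₁ x = G x → fderiv ℝ G₁ x = fderiv ℝ G x + n.smulRight A → (∀ v, fderiv ℝ (fderiv ℝ G₁) x v = fderiv ℝ (fderiv ℝ G) x v + (n v • P + n.smulRight (P v) + n v • n.smulRight W)) → ∀ e : E4, n e = 0 → |MetricCoord.ricAt G₁ x (MetricCoord.sharpAt G x n) e - MetricCoord.ricAt G x (MetricCoord.sharpAt G x n) e| ≤ C * (1 + ‖fderiv ℝ G x‖) * (‖A‖ + ‖P‖) * ‖n‖ ^ 2 * ‖e‖) :=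
  -- LANDED (p143216): cited without `sorry`
  Summit.FinalStateConjecture.FinalStateConjecture.Theorems.SublinearIsFree.Slaving.stub_momRowLinear

/-- **A · MOMENTUM CAPSTONE** (linear relative bound for the momentum rows of the frozen ansatz, from
frozen-vacuum data). Under the hypotheses of FROZEN-VACUUM SLAVING ((V) `e + g₀` vacuum on late hole tubes,
(S) `e → 0` in `C³` on core-free slabs) and ML: for every hole `i`, `R`, `r₀ ≥ rinᵢ`, `ε > 0`, eventually, at
every tube point `x` and every `l ≥ 1` with `‖Dg₀(x)‖ ≤ l` and `‖D²g₀(x)(w)‖ ≤ l‖w‖` for SPATIAL `w`: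
`|Ric(g₀)(x)(♯dx⁰, e_j)| ≤ ε l` (weight `l`, not `l²`: no `∂₀²g₀`, no `(∂₀g₀)²` in the momentum rows).
Mechanism: `rows(g₀) − rows(e + g₀)` split at the intermediate field `g₀ + ẽ` (`ẽ` = `e` made `x⁰`-independent):
the normal part is ML(ii) (`≤ C(1+l)‖e‖_{C²}`), the slice part is a difference of the smooth row functional
of the `2`-jet at FIXED normal data `ν`, affine in `ν` by ML(i), hence Lipschitz in the slice data with constant
`C₁ + C₂|ν|` on the compact set of jet-free slice data of the ansatz (…StubSlaving12JetCompact, …AnsatzBound).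
Size L. [folklore] -/
theorem stub_momCapstone :
    ∀ (N : ℕ) (M a rin : Fin N → ℝ) (Λ : Fin N → ℝ → lorentzGroup) (ξ : Fin N → ℝ → E3) (γ : ℝ) (e : E4 → E4 →L[ℝ] E4 →L[ℝ] ℝ), (∀ i, Kerr.IsSubextremal (M i) (a i) ∧ Kerr.rMinus (M i) (a i) < rin i ∧ rin i < Kerr.rPlus (M i) (a i)) → (∀ i t, |((Λ i t : E4 ≃L[ℝ] E4) (E4.basisVector 0)) 0| ≤ γ) → (∀ i, ContDiff ℝ ((⊤ : ℕ∞) : WithTop ℕ∞) (ξ i) ∧ ContDiff ℝ ((⊤ : ℕ∞) : WithTop ℕ∞) (fun t ↦ ((Λ i t : E4 ≃L[ℝ] E4) : E4 →L[ℝ] E4))) → (∀ i j, i ≠ j → Tendsto (fun t ↦ ‖ξ i t - ξ j t‖) atTop atTop) → (∀ (i : Fin N) (R r₀ : ℝ), rin i ≤ r₀ → ∃ T : ℝ, MetricCoord.IsMetricOn (fun z : E4 ↦ e z + (Minkowski.bilin + ∑ i, (boostedKerrBilin (Λ i (z 0)) (E4.ofTimeSpace (z 0) (ξ i (z 0)))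 (M i) (a i) z - Minkowski.bilin))) {x : E4 | T < x 0 ∧ ‖E4.spatial x - ξ i (x 0)‖ < R ∧ r₀ < Kerr.radius (a i) (poincareInv (Λ i (x 0)) (E4.ofTimeSpace (x 0) (ξ i (x 0))) x)} ∧ ∀ x : E4, T < x 0 → ‖E4.spatial x - ξ i (x 0)‖ < R → r₀ < Kerr.radius (a i) (poincareInv (Λ i (x 0)) (E4.ofTimeSpace (x 0) (ξ i (x 0))) x) → (∀ j, rin j < Kerr.radius (a j) (poincareInv (Λ j (x 0)) (E4.ofTimeSpace (x 0) (ξ j (x 0))) x)) ∧ MetricCoord.ricAt (fun z : E4 ↦ e z + (Minkowski.bilin + ∑ i, (boostedKerrBilin (Λ i (z 0)) (E4.ofTimeSpace (z 0) (ξ i (z 0))) (M i) (a i) z - Minkowski.bilin))) x = 0) → Tendsto (fun t : ℝ ↦ supCkENorm {x : E4 | x 0 = t ∧ ∀ j, rin j < Kerr.radius (a j) (poincareInv (Λ j (x 0)) (E4.ofTimeSpace (x 0) (ξ j (x 0))) x)} 3 e) atTop (𝓝 0) → (∀ {G G₁ G₂ G₃ : E4 → E4 →L[ℝ] E4 →L[ℝ]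 ℝ} {V : Set E4} {x : E4} {n : E4 →L[ℝ] ℝ} {A₁ A₂ : E4 →L[ℝ] E4 →L[ℝ] ℝ} {P₁ P₂ : E4 →L[ℝ] E4 →L[ℝ] E4 →L[ℝ] ℝ} {W₁ W₂ W₃ : E4 →L[ℝ] E4 →L[ℝ] ℝ} (c₁ c₂ : ℝ), MetricCoord.IsMetricOn G V → MetricCoord.IsMetricOn G₁ V → MetricCoord.IsMetricOn G₂ V → MetricCoord.IsMetricOn G₃ V → x ∈ V → G₁ x = G x → G₂ x = G x → G₃ x = G x → fderiv ℝ G₁ x = fderiv ℝ G x + n.smulRight A₁ → fderiv ℝ G₂ x = fderiv ℝ G x + n.smulRight A₂ → fderiv ℝ G₃ x = fderiv ℝ G x + n.smulRight (c₁ • A₁ + c₂ • A₂) → (∀ v, fderiv ℝ (fderiv ℝ G₁) x v = fderiv ℝ (fderiv ℝ G) x v + (n v • P₁ + n.smulRight (P₁ v) + n v • n.smulRight W₁)) → (∀ v, fderiv ℝ (fderiv ℝ G₂) x v = fderiv ℝ (fderiv ℝ G) x v + (n v • P₂ + n.smulRight (P₂ v) + n v • n.smulRight W₂)) → (∀ v,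 fderiv ℝ (fderiv ℝ G₃) x v = fderiv ℝ (fderiv ℝ G) x v + (n v • (c₁ • P₁ + c₂ • P₂) + n.smulRight ((c₁ • P₁ + c₂ • P₂) v) + n v • n.smulRight W₃)) → ∀ e : E4, n e = 0 → MetricCoord.ricAt G₃ x (MetricCoord.sharpAt G x n) e - MetricCoord.ricAt G x (MetricCoord.sharpAt G x n) e = c₁ * (MetricCoord.ricAt G₁ x (MetricCoord.sharpAt G x n) e - MetricCoord.ricAt G x (MetricCoord.sharpAt G x n) e) + c₂ * (MetricCoord.ricAt G₂ x (MetricCoord.sharpAt G x n) e - MetricCoord.ricAt G x (MetricCoord.sharpAt G x n) e)) ∧ (∀ μ ν : ℝ, 0 < μ → ∃ C : ℝ, ∀ {G G₁ : E4 → E4 →L[ℝ] E4 →L[ℝ] ℝ} {V : Set E4} {x : E4} {n : E4 →L[ℝ] ℝ} {A : E4 →L[ℝ] E4 →L[ℝ] ℝ} {P : E4 →L[ℝ] E4 →L[ℝ] E4 →L[ℝ] ℝ} {W : E4 →L[ℝ] E4 →L[ℝ] ℝ}, MetricCoord.IsMetricOn G V → MetricCoord.IsMetricOn G₁ V → x ∈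 V → (∀ v : E4, μ * ‖v‖ ≤ ‖G x v‖) → ‖G x‖ ≤ ν → G₁ x = G x → fderiv ℝ G₁ x = fderiv ℝ G x + n.smulRight A → (∀ v, fderiv ℝ (fderiv ℝ G₁) x v = fderiv ℝ (fderiv ℝ G) x v + (n v • P + n.smulRight (P v) + n v • n.smulRight W)) → ∀ e : E4, n e = 0 → |MetricCoord.ricAt G₁ x (MetricCoord.sharpAt G x n) e - MetricCoord.ricAt G x (MetricCoord.sharpAt G x n) e| ≤ C * (1 + ‖fderiv ℝ G x‖) * (‖A‖ + ‖P‖) * ‖n‖ ^ 2 * ‖e‖) → (∀ (i : Fin N) (R r₀ : ℝ), rin i ≤ r₀ → ∀ ε : ℝ, 0 < ε → ∃ T : ℝ, ∀ x : E4, T < x 0 → ‖E4.spatial x - ξ i (x 0)‖ < R → r₀ < Kerr.radius (a i) (poincareInv (Λ i (x 0)) (E4.ofTimeSpace (x 0) (ξ i (x 0))) x) → ∀ l : ℝ, 1 ≤ l → ‖fderiv ℝ (fun z : E4 ↦ Minkowski.bilin + ∑ i, (boostedKerrBilin (Λ i (z 0)) (E4.ofTimeSpace (z 0) (ξ i (z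 0))) (M i) (a i) z - Minkowski.bilin)) x‖ ≤ l → (∀ w : E4, w 0 = 0 → ‖fderiv ℝ (fderiv ℝ (fun z : E4 ↦ Minkowski.bilin + ∑ i, (boostedKerrBilin (Λ i (z 0)) (E4.ofTimeSpace (z 0) (ξ i (z 0))) (M i) (a i) z - Minkowski.bilin))) x w‖ ≤ l * ‖w‖) → ∀ j : Fin 3, |MetricCoord.ricAt (fun z : E4 ↦ Minkowski.bilin + ∑ i, (boostedKerrBilin (Λ i (z 0)) (E4.ofTimeSpace (z 0) (ξ i (z 0))) (M i) (a i) z - Minkowski.bilin)) x (MetricCoord.sharpAt (fun z : E4 ↦ Minkowski.bilin + ∑ i, (boostedKerrBilin (Λ i (z 0)) (E4.ofTimeSpace (z 0) (ξ i (z 0))) (M i) (a i) z - Minkowski.bilin)) x (E4.dx 0)) (E4.basisVector j.succ)| ≤ ε * l) :=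
  -- LANDED (p146198): cited without `sorry`
  Summit.FinalStateConjecture.FinalStateConjecture.Theorems.SublinearIsFree.Slaving.stub_momCapstone

/-- **Bk · COER-mom KERNEL — every boost, every spin** (LEAD's stub). For the painted summand
`K = boostedKerrBilin L 0 M a` (`|a| < M`, ANY `L ∈ O(1,3)`) and an infinitesimal rest-frame Poincaré motion
`(A, d)`, `A` `η`-skew: if the momentum rows `Ric(K + x⁰Var)(x_y)(♯_K dx⁰, e_j)` of the first-order modulated
model vanish at all lab offsets `y` beyond some radius (with painted radius `> 2M`), then `A e₀ = 0`, `d⃗ = 0`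
and, for `a ≠ 0`, `A e₃ = 0` (the motion is instantaneously stabiliser: axial rotation + time translation).
Plan: far-field expansion (Kerr–Schild scaling `g_{M,a}(ρy) = g_{M/ρ,a/ρ}(y)`, `ricAt_comp_dilate`, smooth
dependence on `(M/ρ, a/ρ)`), first order = the flat momentum operator `½(∂_iV_ij − ∂_jV_ii)` of the variation of
LINEARISED boosted Kerr–Schild Schwarzschild plus its spin dipole (at rest: boost rows `∝ (b·ŷ)ŷ/ρ²`, translation
rows `∝ (δ − 3(δ·ŷ)ŷ)/ρ³`, axis rows `∝ (w × ŷ)/ρ³`), rotation covariance, graded perturbation. Seats 0/1 attack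
the same statement by exact rows at axis/tangent points (…SlavingAxisData, …TangentData, …RadiusHessian,
…NullCovectorHessian; certificates COER_momcert_*). Size L/XL. [folklore] -/
theorem stub_coerMomKernel :
    (∀ (M a : ℝ), |a| < M → ∀ (L : lorentzGroup) (A : E4 →L[ℝ] E4) (d : E4) (ρ₀ : ℝ), (∀ u w : E4, Minkowski.bilin (A u) w + Minkowski.bilin u (A w) = 0) → (∀ y : E3, ρ₀ ≤ ‖y‖ → 2 * M < Kerr.radius a (poincareInv L 0 (E4.ofTimeSpace 0 y)) → ∀ j : Fin 3, MetricCoord.ricAt (fun z : E4 ↦ (boostedKerrBilin L 0 M a) z + (z 0) • ((fderiv ℝ (Kerr.bilin M a) (poincareInv L 0 z) (A (poincareInv L 0 z) + d)).bilinearComp (((L : E4 ≃L[ℝ] E4).symm : E4 →L[ℝ] E4)) (((L : E4 ≃L[ℝ] E4).symm : E4 →L[ℝ] E4)) + (Kerr.bilin M a (poincareInv L 0 z)).bilinearComp (A.comp (((L : E4 ≃L[ℝ] E4).symm : E4 →L[ℝ] E4))) (((L : E4 ≃L[ℝ] E4).symm : E4 →L[ℝ] E4)) + (Kerr.bilin M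 a (poincareInv L 0 z)).bilinearComp (((L : E4 ≃L[ℝ] E4).symm : E4 →L[ℝ] E4)) (A.comp (((L : E4 ≃L[ℝ] E4).symm : E4 →L[ℝ] E4))))) (E4.ofTimeSpace 0 y) (MetricCoord.sharpAt (boostedKerrBilin L 0 M a) (E4.ofTimeSpace 0 y) (E4.dx 0)) (E4.basisVector j.succ) = 0) → A (E4.basisVector 0) = 0 ∧ E4.spatial d = 0 ∧ (a ≠ 0 → A (E4.basisVector 3) = 0)) :=
  -- LANDED (p153424, seat 1, far-field programme): cited without `sorry`
  Summit.FinalStateConjecture.FinalStateConjecture.Theorems.SublinearIsFree.Slaving.stub_coerMomKernel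

/-- **Bs · COER-mom, QUANTITATIVE, UNIFORM ON `{|Λe₀⁰| ≤ γ}`, ROBUST IN THE BACKGROUND** (from ML + Bk by
compactness). There are `c, η₀ > 0` and a shell of lab offsets `ρin ≤ ‖y‖ ≤ ρout` (painted radius `> 2M` there
for every Lorentz factor `≤ γ`) such that for every `L` with Lorentz factor `≤ γ`, every `η`-skew `A`, every
`d`, and every metric field `G` whose `2`-jet at the shell events is `η₀`-close to that of `K`, SOME shell
offset `y` has `c (‖A e₀‖ + ‖d⃗‖ + ‖a • A e₃‖) ≤ Σ_j |rows_j(G, G + x⁰Var)(x_y)|`. Mechanism: rows are a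
continuous function of (the `2`-jet of `G`, `L`, `A`, `d`, `y`) through `MetricCoord.ricciJet`, linear in
`(A, d)` by ML; normalise the reduced size to `1` with the stabiliser components removed (rows are invariant
under axial rotations added to `A` and `e₀`-multiples added to `d`); a violating sequence with `ρout = n` has a
limit (compactness of `{|Λe₀⁰| ≤ γ}`, `coer_isCompact_lorentzBounded_s0`) whose rows for `G = K` vanish at ALL
far offsets; Bk. Size M. [folklore] -/
theorem stub_coerMomQuant :
    ∀ (M a γ : ℝ), |a| < M → 1 ≤ γ → (∀ {G G₁ G₂ G₃ : E4 → E4 →L[ℝ] E4 →L[ℝ] ℝ} {V : Set E4} {x : E4} {n : E4 →L[ℝ] ℝ} {A₁ A₂ : E4 →L[ℝ] E4 →L[ℝ] ℝ} {P₁ P₂ : E4 →L[ℝ] E4 →L[ℝ] E4 →L[ℝ] ℝ} {W₁ W₂ W₃ : E4 →L[ℝ] E4 →L[ℝ] ℝ} (c₁ c₂ : ℝ), MetricCoord.IsMetricOn G V → MetricCoord.IsMetricOn G₁ V → MetricCoord.IsMetricOn G₂ V → MetricCoord.IsMetricOn G₃ V → x ∈ V → G₁ x = G x → G₂ x = G x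 → G₃ x = G x → fderiv ℝ G₁ x = fderiv ℝ G x + n.smulRight A₁ → fderiv ℝ G₂ x = fderiv ℝ G x + n.smulRight A₂ → fderiv ℝ G₃ x = fderiv ℝ G x + n.smulRight (c₁ • A₁ + c₂ • A₂) → (∀ v, fderiv ℝ (fderiv ℝ G₁) x v = fderiv ℝ (fderiv ℝ G) x v + (n v • P₁ + n.smulRight (P₁ v) + n v • n.smulRight W₁)) → (∀ v, fderiv ℝ (fderiv ℝ G₂) x v = fderiv ℝ (fderiv ℝ G) x v + (n v • P₂ + n.smulRight (P₂ v) + n v • n.smulRight W₂)) → (∀ v, fderiv ℝ (fderiv ℝ G₃) x v = fderiv ℝ (fderiv ℝ G) x v + (n v • (c₁ • P₁ + c₂ • P₂) + n.smulRight ((c₁ • P₁ + c₂ • P₂) v) + n v • n.smulRight W₃)) → ∀ e : E4, n e = 0 → MetricCoord.ricAt G₃ x (MetricCoord.sharpAt G x n) e - MetricCoord.ricAt G x (MetricCoord.sharpAt G x n) e = c₁ * (MetricCoord.ricAt G₁ x (MetricCoord.sharpAt G x n) e - MetricCoord.ricAt G x (MetricCoord.sharpAt G x n) e) + c₂ * (MetricCoord.ricAt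 G₂ x (MetricCoord.sharpAt G x n) e - MetricCoord.ricAt G x (MetricCoord.sharpAt G x n) e)) ∧ (∀ μ ν : ℝ, 0 < μ → ∃ C : ℝ, ∀ {G G₁ : E4 → E4 →L[ℝ] E4 →L[ℝ] ℝ} {V : Set E4} {x : E4} {n : E4 →L[ℝ] ℝ} {A : E4 →L[ℝ] E4 →L[ℝ] ℝ} {P : E4 →L[ℝ] E4 →L[ℝ] E4 →L[ℝ] ℝ} {W : E4 →L[ℝ] E4 →L[ℝ] ℝ}, MetricCoord.IsMetricOn G V → MetricCoord.IsMetricOn G₁ V → x ∈ V → (∀ v : E4, μ * ‖v‖ ≤ ‖G x v‖) → ‖G x‖ ≤ ν → G₁ x = G x → fderiv ℝ G₁ x = fderiv ℝ G x + n.smulRight A → (∀ v, fderiv ℝ (fderiv ℝ G₁) x v = fderiv ℝ (fderiv ℝ G) x v + (n v • P + n.smulRight (P v) + n v • n.smulRight W)) → ∀ e : E4, n e = 0 → |MetricCoord.ricAt G₁ x (MetricCoord.sharpAt G x n) e - MetricCoord.ricAt G x (MetricCoord.sharpAt G x n) e| ≤ C * (1 + ‖fderiv ℝ G x‖) * (‖A‖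 + ‖P‖) * ‖n‖ ^ 2 * ‖e‖) → (∀ (M a : ℝ), |a| < M → ∀ (L : lorentzGroup) (A : E4 →L[ℝ] E4) (d : E4) (ρ₀ : ℝ), (∀ u w : E4, Minkowski.bilin (A u) w + Minkowski.bilin u (A w) = 0) → (∀ y : E3, ρ₀ ≤ ‖y‖ → 2 * M < Kerr.radius a (poincareInv L 0 (E4.ofTimeSpace 0 y)) → ∀ j : Fin 3, MetricCoord.ricAt (fun z : E4 ↦ (boostedKerrBilin L 0 M a) z + (z 0) • ((fderiv ℝ (Kerr.bilin M a) (poincareInv L 0 z) (A (poincareInv L 0 z) + d)).bilinearComp (((L : E4 ≃L[ℝ] E4).symm : E4 →L[ℝ] E4)) (((L : E4 ≃L[ℝ] E4).symm : E4 →L[ℝ] E4)) + (Kerr.bilin M a (poincareInv L 0 z)).bilinearComp (A.comp (((L : E4 ≃L[ℝ] E4).symm : E4 →L[ℝ] E4))) (((L : E4 ≃L[ℝ] E4).symm : E4 →L[ℝ] E4)) + (Kerr.bilin M a (poincareInv L 0 z)).bilinearComp (((L : E4 ≃L[ℝ] E4).symm : E4 →L[ℝ] E4)) (A.comp (((L :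 E4 ≃L[ℝ] E4).symm : E4 →L[ℝ] E4))))) (E4.ofTimeSpace 0 y) (MetricCoord.sharpAt (boostedKerrBilin L 0 M a) (E4.ofTimeSpace 0 y) (E4.dx 0)) (E4.basisVector j.succ) = 0) → A (E4.basisVector 0) = 0 ∧ E4.spatial d = 0 ∧ (a ≠ 0 → A (E4.basisVector 3) = 0)) → (∃ c ρin ρout η₀ : ℝ, 0 < c ∧ 0 < η₀ ∧ 0 < ρin ∧ ρin ≤ ρout ∧ (∀ (L : lorentzGroup) (y : E3), |((L : E4 ≃L[ℝ] E4) (E4.basisVector 0)) 0| ≤ γ → ρin ≤ ‖y‖ → 2 * M < Kerr.radius a (poincareInv L 0 (E4.ofTimeSpace 0 y))) ∧ ∀ (L : lorentzGroup) (A : E4 →L[ℝ] E4) (d : E4) (G : E4 → E4 →L[ℝ] E4 →L[ℝ] ℝ) (V : Set E4), |((L : E4 ≃L[ℝ] E4) (E4.basisVector 0)) 0| ≤ γ → (∀ u w : E4, Minkowski.bilin (A u) w + Minkowski.bilin u (A w) = 0) → MetricCoord.IsMetricOn G V → (∀ y : E3, ρin ≤ ‖y‖ → ‖y‖ ≤ ρout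 → (E4.ofTimeSpace 0 y) ∈ V ∧ ‖G (E4.ofTimeSpace 0 y) - boostedKerrBilin L 0 M a (E4.ofTimeSpace 0 y)‖ ≤ η₀ ∧ ‖fderiv ℝ G (E4.ofTimeSpace 0 y) - fderiv ℝ (boostedKerrBilin L 0 M a) (E4.ofTimeSpace 0 y)‖ ≤ η₀ ∧ ‖fderiv ℝ (fderiv ℝ G) (E4.ofTimeSpace 0 y) - fderiv ℝ (fderiv ℝ (boostedKerrBilin L 0 M a)) (E4.ofTimeSpace 0 y)‖ ≤ η₀) → ∃ y : E3, ρin ≤ ‖y‖ ∧ ‖y‖ ≤ ρout ∧ c * (‖A (E4.basisVector 0)‖ + ‖E4.spatial d‖ + ‖a • A (E4.basisVector 3)‖) ≤ ∑ j : Fin 3, |MetricCoord.ricAt (fun z : E4 ↦ G z + (z 0) • ((fderiv ℝ (Kerr.bilin M a) (poincareInv L 0 z) (A (poincareInv L 0 z) + d)).bilinearComp (((L : E4 ≃L[ℝ] E4).symm : E4 →L[ℝ] E4)) (((L : E4 ≃L[ℝ] E4).symm : E4 →L[ℝ] E4)) + (Kerr.bilin M a (poincareInv L 0 z)).bilinearComp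 (A.comp (((L : E4 ≃L[ℝ] E4).symm : E4 →L[ℝ] E4))) (((L : E4 ≃L[ℝ] E4).symm : E4 →L[ℝ] E4)) + (Kerr.bilin M a (poincareInv L 0 z)).bilinearComp (((L : E4 ≃L[ℝ] E4).symm : E4 →L[ℝ] E4)) (A.comp (((L : E4 ≃L[ℝ] E4).symm : E4 →L[ℝ] E4))))) (E4.ofTimeSpace 0 y) (MetricCoord.sharpAt G (E4.ofTimeSpace 0 y) (E4.dx 0)) (E4.basisVector j.succ) - MetricCoord.ricAt G (E4.ofTimeSpace 0 y) (MetricCoord.sharpAt G (E4.ofTimeSpace 0 y) (E4.dx 0)) (E4.basisVector j.succ)|) :=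
  -- LANDED (p145363): cited without `sorry`
  Summit.FinalStateConjecture.FinalStateConjecture.Theorems.SublinearIsFree.Slaving.stub_coerMomQuant

/-- **C · COER-B (principal symbol on first variations), QUANTITATIVE, UNIFORM, ROBUST** — from the LANDED
kernels by compactness. There are `c, η₀ > 0` and a shell `ρin ≤ ‖y‖ ≤ ρout` (painted radius `> 2M`) such that
for `L` with Lorentz factor `≤ γ`, `A` `η`-skew, `d`, and metric fields `G, G'` with `‖G − K‖ ≤ η₀` at the shell
events, equal `1`-jets there and `D²G'(x)(v)(w) = D²G(x)(v)(w) + v⁰w⁰ Var(x)`: some shell offset has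
`c (‖A e₀‖ + ‖d⃗‖ + ‖a • A e₃‖) ≤ ‖Ric G'(x_y) − Ric G(x_y)‖`. Mechanism: the difference IS
`σ_{G(x)}(dx⁰)[Var x]` (`ricAt_apply_eq_add_symbol_of_jets`, …COERSymbol), continuous in (value, `L`, `A`, `d`,
`y`); compactness as in Bs; kernel at `G(x) = K(x)`: `σ(dx⁰)[Var] = 0 ⇒ Var = 0` (`Var` is a null pair,
`hasDerivAt_boostedKerrBilin_path` / `lieDeriv_skew_eq_nullPair`; `eq_zero_of_symbol_nullPair_eq_zero`), and
`Var = 0` at three rest-axis events of one lab slab ⇒ stabiliser (`axisKernel_slab`, …SlavingAxisKernel, all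
spins; the shell is chosen to contain them). Size M. [folklore] -/
theorem stub_coerSymbolQuant :
    ∀ (M a γ : ℝ), |a| < M → 1 ≤ γ → (∃ c ρin ρout η₀ : ℝ, 0 < c ∧ 0 < η₀ ∧ 0 < ρin ∧ ρin ≤ ρout ∧ (∀ (L : lorentzGroup) (y : E3), |((L : E4 ≃L[ℝ] E4) (E4.basisVector 0)) 0| ≤ γ → ρin ≤ ‖y‖ → 2 * M < Kerr.radius a (poincareInv L 0 (E4.ofTimeSpace 0 y))) ∧ ∀ (L : lorentzGroup) (A : E4 →L[ℝ] E4) (d : E4) (G G' : E4 → E4 →L[ℝ] E4 →L[ℝ] ℝ) (V : Set E4), |((L : E4 ≃L[ℝ] E4) (E4.basisVector 0)) 0| ≤ γ → (∀ u w : E4, Minkowski.bilin (A u) w + Minkowski.bilin u (A w) = 0) → MetricCoord.IsMetricOn G V → MetricCoord.IsMetricOn G' V → (∀ y : E3, ρin ≤ ‖y‖ → ‖y‖ ≤ ρout → (E4.ofTimeSpace 0 y) ∈ V ∧ ‖G (E4.ofTimeSpace 0 y) - boostedKerrBilin L 0 M a (E4.ofTimeSpace 0 y)‖ ≤ η₀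 ∧ G' (E4.ofTimeSpace 0 y) = G (E4.ofTimeSpace 0 y) ∧ fderiv ℝ G' (E4.ofTimeSpace 0 y) = fderiv ℝ G (E4.ofTimeSpace 0 y) ∧ ∀ v : E4, fderiv ℝ (fderiv ℝ G') (E4.ofTimeSpace 0 y) v = fderiv ℝ (fderiv ℝ G) (E4.ofTimeSpace 0 y) v + (v 0) • (E4.dx 0).smulRight ((fderiv ℝ (Kerr.bilin M a) (poincareInv L 0 (E4.ofTimeSpace 0 y)) (A (poincareInv L 0 (E4.ofTimeSpace 0 y)) + d)).bilinearComp (((L : E4 ≃L[ℝ] E4).symm : E4 →L[ℝ] E4)) (((L : E4 ≃L[ℝ] E4).symm : E4 →L[ℝ] E4)) + (Kerr.bilin M a (poincareInv L 0 (E4.ofTimeSpace 0 y))).bilinearComp (A.comp (((L : E4 ≃L[ℝ] E4).symm : E4 →L[ℝ] E4))) (((L : E4 ≃L[ℝ] E4).symm : E4 →L[ℝ] E4)) + (Kerr.bilin M a (poincareInv L 0 (E4.ofTimeSpace 0 y))).bilinearComp (((L : E4 ≃L[ℝ] E4).symm : E4 →L[ℝ] E4)) (A.comp (((L : E4 ≃L[ℝ]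 E4).symm : E4 →L[ℝ] E4))))) → ∃ y : E3, ρin ≤ ‖y‖ ∧ ‖y‖ ≤ ρout ∧ c * (‖A (E4.basisVector 0)‖ + ‖E4.spatial d‖ + ‖a • A (E4.basisVector 3)‖) ≤ ‖MetricCoord.ricAt G' (E4.ofTimeSpace 0 y) - MetricCoord.ricAt G (E4.ofTimeSpace 0 y)‖) :=
  -- LANDED (p145235): cited without `sorry`
  Summit.FinalStateConjecture.FinalStateConjecture.Theorems.SublinearIsFree.Slaving.stub_coerSymbolQuant

/-- **D · FIRST-ORDER SLAVING by linear absorption** (the M-step). Kinematic clauses + ML + robust quantitative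
COER-mom for every hole + the momentum capstone (M) ⇒ for every hole: `u̇ᵢ → 0`, `ξ̇ᵢ − v(Λᵢ) → 0`, and
`aᵢ ≠ 0 → ṅᵢ → 0` (`uᵢ = Λᵢe₀`, `nᵢ = Λᵢe₃`). Mechanism (max-hole trick): with `J¹ᵢ(t)` the reduced first jet
and `J¹_max = maxⱼ J¹ⱼ`, at a late time `t` compare `g₀` on `Σ_t` near hole `i` with the INERTIAL continuation
`G^in` of all holes from `Σ_t` (same slice values; normal first jets differ by `Σⱼ Varⱼ`; `ricAt_inertialSummand`
+ `abs_ricAt_sub_le_jet` make `rows(G^in)` small): `rows(g₀) − rows(G^in) = Σⱼ Lin(Varⱼ)` (ML), far terms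
`≤ o(1) J¹_max` (ML bound, `Varⱼ = O(Mⱼ/Dᵢⱼ) J¹ⱼ` at hole `i`), own term `≥ c J¹ᵢ` at the good offset (COER-mom
with `G := G^in` re-centred, `ricAt_pullMetric`), and (M) with `l := C(1 + J¹_max)` (jet bounds through
UNTWISTED frames: pure boost for `a = 0`, `boostedKerrBilin_zero_spin_eq_boost_repr`; `Λ·rotL θ` for `a ≠ 0`,
`exists_untwisting_angle'`; far summands by `exists_norm_iteratedFDeriv_ksPert_frame_le_pow`):
`c J¹ᵢ ≤ Cε(1 + J¹_max) + o(1)(1 + J¹_max)` for every `i`, hence `J¹_max → 0`. Size L. [folklore] -/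
theorem stub_firstOrderSlaving :
    ∀ (N : ℕ) (M a rin : Fin N → ℝ) (Λ : Fin N → ℝ → lorentzGroup) (ξ : Fin N → ℝ → E3) (γ : ℝ), (∀ i, Kerr.IsSubextremal (M i) (a i) ∧ Kerr.rMinus (M i) (a i) < rin i ∧ rin i < Kerr.rPlus (M i) (a i)) → (∀ i t, |((Λ i t : E4 ≃L[ℝ] E4) (E4.basisVector 0)) 0| ≤ γ) → (∀ i, ContDiff ℝ ((⊤ : ℕ∞) : WithTop ℕ∞) (ξ i) ∧ ContDiff ℝ ((⊤ : ℕ∞) : WithTop ℕ∞) (fun t ↦ ((Λ i t : E4 ≃L[ℝ] E4) : E4 →L[ℝ] E4))) → (∀ i j, i ≠ j → Tendsto (fun t ↦ ‖ξ i t - ξ j t‖) atTop atTop) → (∀ {G G₁ G₂ G₃ : E4 → E4 →L[ℝ] E4 →L[ℝ] ℝ} {V : Set E4} {x : E4} {n : E4 →L[ℝ] ℝ} {A₁ A₂ : E4 →L[ℝ] E4 →L[ℝ] ℝ} {P₁ P₂ : E4 →L[ℝ] E4 →L[ℝ] E4 →L[ℝ] ℝ} {W₁ W₂ W₃ : E4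 →L[ℝ] E4 →L[ℝ] ℝ} (c₁ c₂ : ℝ), MetricCoord.IsMetricOn G V → MetricCoord.IsMetricOn G₁ V → MetricCoord.IsMetricOn G₂ V → MetricCoord.IsMetricOn G₃ V → x ∈ V → G₁ x = G x → G₂ x = G x → G₃ x = G x → fderiv ℝ G₁ x = fderiv ℝ G x + n.smulRight A₁ → fderiv ℝ G₂ x = fderiv ℝ G x + n.smulRight A₂ → fderiv ℝ G₃ x = fderiv ℝ G x + n.smulRight (c₁ • A₁ + c₂ • A₂) → (∀ v, fderiv ℝ (fderiv ℝ G₁) x v = fderiv ℝ (fderiv ℝ G) x v + (n v • P₁ + n.smulRight (P₁ v) + n v • n.smulRight W₁)) → (∀ v, fderiv ℝ (fderiv ℝ G₂) x v = fderiv ℝ (fderiv ℝ G) x v + (n v • P₂ + n.smulRight (P₂ v) + n v • n.smulRight W₂)) → (∀ v, fderiv ℝ (fderiv ℝ G₃) x v = fderiv ℝ (fderiv ℝ G) x v + (n v • (c₁ • P₁ + c₂ • P₂) + n.smulRight ((c₁ • P₁ + c₂ • P₂) v) + n v • n.smulRight W₃)) → ∀ e : E4, n e = 0 → MetricCoord.ricAt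 G₃ x (MetricCoord.sharpAt G x n) e - MetricCoord.ricAt G x (MetricCoord.sharpAt G x n) e = c₁ * (MetricCoord.ricAt G₁ x (MetricCoord.sharpAt G x n) e - MetricCoord.ricAt G x (MetricCoord.sharpAt G x n) e) + c₂ * (MetricCoord.ricAt G₂ x (MetricCoord.sharpAt G x n) e - MetricCoord.ricAt G x (MetricCoord.sharpAt G x n) e)) ∧ (∀ μ ν : ℝ, 0 < μ → ∃ C : ℝ, ∀ {G G₁ : E4 → E4 →L[ℝ] E4 →L[ℝ] ℝ} {V : Set E4} {x : E4} {n : E4 →L[ℝ] ℝ} {A : E4 →L[ℝ] E4 →L[ℝ] ℝ} {P : E4 →L[ℝ] E4 →L[ℝ] E4 →L[ℝ] ℝ} {W : E4 →L[ℝ] E4 →L[ℝ] ℝ}, MetricCoord.IsMetricOn G V → MetricCoord.IsMetricOn G₁ V → x ∈ V → (∀ v : E4, μ * ‖v‖ ≤ ‖G x v‖) → ‖G x‖ ≤ ν → G₁ x = G x → fderiv ℝ G₁ x = fderiv ℝ G x + n.smulRight A → (∀ v, fderiv ℝ (fderiv ℝ G₁) x v = fderiv ℝ (fderiv ℝ G)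 x v + (n v • P + n.smulRight (P v) + n v • n.smulRight W)) → ∀ e : E4, n e = 0 → |MetricCoord.ricAt G₁ x (MetricCoord.sharpAt G x n) e - MetricCoord.ricAt G x (MetricCoord.sharpAt G x n) e| ≤ C * (1 + ‖fderiv ℝ G x‖) * (‖A‖ + ‖P‖) * ‖n‖ ^ 2 * ‖e‖) → (∀ i : Fin N, (∃ c ρin ρout η₀ : ℝ, 0 < c ∧ 0 < η₀ ∧ 0 < ρin ∧ ρin ≤ ρout ∧ (∀ (L : lorentzGroup) (y : E3), |((L : E4 ≃L[ℝ] E4) (E4.basisVector 0)) 0| ≤ γ → ρin ≤ ‖y‖ → 2 * (M i) < Kerr.radius (a i) (poincareInv L 0 (E4.ofTimeSpace 0 y))) ∧ ∀ (L : lorentzGroup) (A : E4 →L[ℝ] E4) (d : E4) (G : E4 → E4 →L[ℝ] E4 →L[ℝ] ℝ) (V : Set E4), |((L : E4 ≃L[ℝ] E4) (E4.basisVector 0)) 0| ≤ γ → (∀ u w : E4, Minkowski.bilin (A u) w + Minkowski.bilin u (A w) = 0) → MetricCoord.IsMetricOn G V → (∀ y : E3, ρin ≤ ‖y‖ → ‖y‖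 ≤ ρout → (E4.ofTimeSpace 0 y) ∈ V ∧ ‖G (E4.ofTimeSpace 0 y) - boostedKerrBilin L 0 (M i) (a i) (E4.ofTimeSpace 0 y)‖ ≤ η₀ ∧ ‖fderiv ℝ G (E4.ofTimeSpace 0 y) - fderiv ℝ (boostedKerrBilin L 0 (M i) (a i)) (E4.ofTimeSpace 0 y)‖ ≤ η₀ ∧ ‖fderiv ℝ (fderiv ℝ G) (E4.ofTimeSpace 0 y) - fderiv ℝ (fderiv ℝ (boostedKerrBilin L 0 (M i) (a i))) (E4.ofTimeSpace 0 y)‖ ≤ η₀) → ∃ y : E3, ρin ≤ ‖y‖ ∧ ‖y‖ ≤ ρout ∧ c * (‖A (E4.basisVector 0)‖ + ‖E4.spatial d‖ + ‖(a i) • A (E4.basisVector 3)‖) ≤ ∑ j : Fin 3, |MetricCoord.ricAt (fun z : E4 ↦ G z + (z 0) • ((fderiv ℝ (Kerr.bilin (M i) (a i)) (poincareInv L 0 z) (A (poincareInv L 0 z) + d)).bilinearComp (((L : E4 ≃L[ℝ] E4).symm : E4 →L[ℝ] E4)) (((L : E4 ≃L[ℝ] E4).symm : E4 →L[ℝ]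 E4)) + (Kerr.bilin (M i) (a i) (poincareInv L 0 z)).bilinearComp (A.comp (((L : E4 ≃L[ℝ] E4).symm : E4 →L[ℝ] E4))) (((L : E4 ≃L[ℝ] E4).symm : E4 →L[ℝ] E4)) + (Kerr.bilin (M i) (a i) (poincareInv L 0 z)).bilinearComp (((L : E4 ≃L[ℝ] E4).symm : E4 →L[ℝ] E4)) (A.comp (((L : E4 ≃L[ℝ] E4).symm : E4 →L[ℝ] E4))))) (E4.ofTimeSpace 0 y) (MetricCoord.sharpAt G (E4.ofTimeSpace 0 y) (E4.dx 0)) (E4.basisVector j.succ) - MetricCoord.ricAt G (E4.ofTimeSpace 0 y) (MetricCoord.sharpAt G (E4.ofTimeSpace 0 y) (E4.dx 0)) (E4.basisVector j.succ)|)) → (∀ (i : Fin N) (R r₀ : ℝ), rin i ≤ r₀ → ∀ ε : ℝ, 0 < ε → ∃ T : ℝ, ∀ x : E4, T < x 0 → ‖E4.spatial x - ξ i (x 0)‖ < R → r₀ < Kerr.radius (a i) (poincareInv (Λ i (x 0)) (E4.ofTimeSpace (x 0) (ξ i (x 0))) x) → ∀ l : ℝ, 1 ≤ l → ‖fderiv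 ℝ (fun z : E4 ↦ Minkowski.bilin + ∑ i, (boostedKerrBilin (Λ i (z 0)) (E4.ofTimeSpace (z 0) (ξ i (z 0))) (M i) (a i) z - Minkowski.bilin)) x‖ ≤ l → (∀ w : E4, w 0 = 0 → ‖fderiv ℝ (fderiv ℝ (fun z : E4 ↦ Minkowski.bilin + ∑ i, (boostedKerrBilin (Λ i (z 0)) (E4.ofTimeSpace (z 0) (ξ i (z 0))) (M i) (a i) z - Minkowski.bilin))) x w‖ ≤ l * ‖w‖) → ∀ j : Fin 3, |MetricCoord.ricAt (fun z : E4 ↦ Minkowski.bilin + ∑ i, (boostedKerrBilin (Λ i (z 0)) (E4.ofTimeSpace (z 0) (ξ i (z 0))) (M i) (a i) z - Minkowski.bilin)) x (MetricCoord.sharpAt (fun z : E4 ↦ Minkowski.bilin + ∑ i, (boostedKerrBilin (Λ i (z 0)) (E4.ofTimeSpace (z 0) (ξ i (z 0))) (M i) (a i) z - Minkowski.bilin)) x (E4.dx 0)) (E4.basisVector j.succ)| ≤ ε * l) → (∀ i : Fin N, Tendsto (fun t ↦ iteratedDeriv 1 (fun s ↦ (((Λ i s : lorentzGroup) : E4 ≃L[ℝ]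 E4) (E4.basisVector 0))) t) atTop (𝓝 0) ∧ Tendsto (fun t ↦ iteratedDeriv 0 (fun s ↦ deriv (ξ i) s - (((((Λ i s : lorentzGroup) : E4 ≃L[ℝ] E4) (E4.basisVector 0)) 0)⁻¹ • E4.spatial (((Λ i s : lorentzGroup) : E4 ≃L[ℝ] E4) (E4.basisVector 0)))) t) atTop (𝓝 0) ∧ (a i ≠ 0 → Tendsto (fun t ↦ iteratedDeriv 1 (fun s ↦ (((Λ i s : lorentzGroup) : E4 ≃L[ℝ] E4) (E4.basisVector 3))) t) atTop (𝓝 0))) :=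
  -- LANDED (p148069): cited without `sorry`
  Summit.FinalStateConjecture.FinalStateConjecture.Theorems.SublinearIsFree.Slaving.stub_firstOrderSlaving

/-- **EF · SECOND- AND THIRD-ORDER SLAVING** (the R- and C³-steps; soft once the first order is known).
Kinematic clauses + robust quantitative COER-B for every hole + the landed jet-relative `C²`/`C³` Ricci bound
of the ansatz (conclusion of `exists_relRicci_of_frozenVacuum`, here a hypothesis) + first-order slaving ⇒
orders `2, 3` of `uᵢ` (and of `nᵢ` when `aᵢ ≠ 0`) and orders `1, 2` of the centre mismatch tend to `0`.
Mechanism: `Ric(g₀)(x) = Ric(G₁)(x) + σ(dx⁰)[Σⱼ Varⱼ(second-order direction)]`,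
`G₁ := g₀ − ½(x⁰ − t)² B̃` (`ricAt_apply_eq_add_symbol_of_jets`); `|Ric(G₁) − Ric(G^in)| ≤ L ‖j₂G₁ − j₂G^in‖ =
O(J¹ + (J¹)²)` by the Lipschitz bound of `ricciJet` near the compact set of inertial jets
(`exists_uniform_lipschitz_near_isCompact`, …JetCompact/JetCompare — legitimate because `J¹ → 0`); COER-B at the
good offset; the `C²` clause with `l := C(1 + J¹_max + (J²_max)^{1/2})`; absorption ⇒ `J²_max → 0`. Third
order likewise with `fderiv_ricAt_eq_comp_jetMap`, `norm_fderiv_ricAt_le_of_jets`, `G₂ := g₀ − (x⁰ − t)³ B̃₃/6`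
and the `C³` clause. With untwisted frames `S(t)`, `S̈ = (Ȧ + A²)S`: the `A²` part is `O((J¹)²)` and `Ȧ` is
`η`-skew, so the second/third-order directions are again of the form `Var`. Size L. [folklore] -/
theorem stub_higherOrderSlaving :
    ∀ (N : ℕ) (M a rin : Fin N → ℝ) (Λ : Fin N → ℝ → lorentzGroup) (ξ : Fin N → ℝ → E3) (γ : ℝ), (∀ i, Kerr.IsSubextremal (M i) (a i) ∧ Kerr.rMinus (M i) (a i) < rin i ∧ rin i < Kerr.rPlus (M i) (a i)) → (∀ i t, |((Λ i t : E4 ≃L[ℝ] E4) (E4.basisVector 0)) 0| ≤ γ) → (∀ i, ContDiff ℝ ((⊤ : ℕ∞) : WithTop ℕ∞) (ξ i) ∧ ContDiff ℝ ((⊤ : ℕ∞) : WithTop ℕ∞) (fun t ↦ ((Λ i t : E4 ≃L[ℝ] E4) : E4 →L[ℝ] E4))) → (∀ i j, i ≠ j → Tendsto (fun t ↦ ‖ξ i t - ξ j t‖) atTop atTop) → (∀ i : Fin N, (∃ c ρin ρout η₀ : ℝ, 0 < c ∧ 0 < η₀ ∧ 0 < ρin ∧ ρin ≤ ρout ∧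 (∀ (L : lorentzGroup) (y : E3), |((L : E4 ≃L[ℝ] E4) (E4.basisVector 0)) 0| ≤ γ → ρin ≤ ‖y‖ → 2 * (M i) < Kerr.radius (a i) (poincareInv L 0 (E4.ofTimeSpace 0 y))) ∧ ∀ (L : lorentzGroup) (A : E4 →L[ℝ] E4) (d : E4) (G G' : E4 → E4 →L[ℝ] E4 →L[ℝ] ℝ) (V : Set E4), |((L : E4 ≃L[ℝ] E4) (E4.basisVector 0)) 0| ≤ γ → (∀ u w : E4, Minkowski.bilin (A u) w + Minkowski.bilin u (A w) = 0) → MetricCoord.IsMetricOn G V → MetricCoord.IsMetricOn G' V → (∀ y : E3, ρin ≤ ‖y‖ → ‖y‖ ≤ ρout → (E4.ofTimeSpace 0 y) ∈ V ∧ ‖G (E4.ofTimeSpace 0 y) - boostedKerrBilin L 0 (M i) (a i) (E4.ofTimeSpace 0 y)‖ ≤ η₀ ∧ G' (E4.ofTimeSpace 0 y) = G (E4.ofTimeSpace 0 y) ∧ fderiv ℝ G' (E4.ofTimeSpace 0 y) = fderiv ℝ G (E4.ofTimeSpace 0 y) ∧ ∀ v : E4, fderiv ℝ (fderiv ℝ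 G') (E4.ofTimeSpace 0 y) v = fderiv ℝ (fderiv ℝ G) (E4.ofTimeSpace 0 y) v + (v 0) • (E4.dx 0).smulRight ((fderiv ℝ (Kerr.bilin (M i) (a i)) (poincareInv L 0 (E4.ofTimeSpace 0 y)) (A (poincareInv L 0 (E4.ofTimeSpace 0 y)) + d)).bilinearComp (((L : E4 ≃L[ℝ] E4).symm : E4 →L[ℝ] E4)) (((L : E4 ≃L[ℝ] E4).symm : E4 →L[ℝ] E4)) + (Kerr.bilin (M i) (a i) (poincareInv L 0 (E4.ofTimeSpace 0 y))).bilinearComp (A.comp (((L : E4 ≃L[ℝ] E4).symm : E4 →L[ℝ] E4))) (((L : E4 ≃L[ℝ] E4).symm : E4 →L[ℝ] E4)) + (Kerr.bilin (M i) (a i) (poincareInv L 0 (E4.ofTimeSpace 0 y))).bilinearComp (((L : E4 ≃L[ℝ] E4).symm : E4 →L[ℝ] E4)) (A.comp (((L : E4 ≃L[ℝ] E4).symm : E4 →L[ℝ] E4))))) → ∃ y : E3, ρin ≤ ‖y‖ ∧ ‖y‖ ≤ ρout ∧ c * (‖A (E4.basisVector 0)‖ + ‖E4.spatial d‖ + ‖(a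 i) • A (E4.basisVector 3)‖) ≤ ‖MetricCoord.ricAt G' (E4.ofTimeSpace 0 y) - MetricCoord.ricAt G (E4.ofTimeSpace 0 y)‖)) → (∀ (i : Fin N) (R r₀ : ℝ), rin i ≤ r₀ → ∀ ε : ℝ, 0 < ε → ∃ T : ℝ, ∀ x : E4, T < x 0 → ‖E4.spatial x - ξ i (x 0)‖ < R → r₀ < Kerr.radius (a i) (poincareInv (Λ i (x 0)) (E4.ofTimeSpace (x 0) (ξ i (x 0))) x) → ∀ l : ℝ, 1 ≤ l → ‖fderiv ℝ (fun z : E4 ↦ Minkowski.bilin + ∑ i, (boostedKerrBilin (Λ i (z 0)) (E4.ofTimeSpace (z 0) (ξ i (z 0))) (M i) (a i) z - Minkowski.bilin)) x‖ ≤ l → ‖fderiv ℝ (fderiv ℝ (fun z : E4 ↦ Minkowski.bilin + ∑ i, (boostedKerrBilin (Λ i (z 0)) (E4.ofTimeSpace (z 0) (ξ i (z 0))) (M i) (a i) z - Minkowski.bilin))) x‖ ≤ l ^ 2 → ‖MetricCoord.ricAt (fun z : E4 ↦ Minkowski.bilin + ∑ i, (boostedKerrBilin (Λ i (z 0)) (E4.ofTimeSpace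 (z 0) (ξ i (z 0))) (M i) (a i) z - Minkowski.bilin)) x‖ ≤ ε * l ^ 2 ∧ (‖fderiv ℝ (fderiv ℝ (fderiv ℝ (fun z : E4 ↦ Minkowski.bilin + ∑ i, (boostedKerrBilin (Λ i (z 0)) (E4.ofTimeSpace (z 0) (ξ i (z 0))) (M i) (a i) z - Minkowski.bilin)))) x‖ ≤ l ^ 3 → ‖fderiv ℝ (MetricCoord.ricAt (fun z : E4 ↦ Minkowski.bilin + ∑ i, (boostedKerrBilin (Λ i (z 0)) (E4.ofTimeSpace (z 0) (ξ i (z 0))) (M i) (a i) z - Minkowski.bilin))) x‖ ≤ ε * l ^ 3)) → (∀ i : Fin N, Tendsto (fun t ↦ iteratedDeriv 1 (fun s ↦ (((Λ i s : lorentzGroup) : E4 ≃L[ℝ] E4) (E4.basisVector 0))) t) atTop (𝓝 0) ∧ Tendsto (fun t ↦ iteratedDeriv 0 (fun s ↦ deriv (ξ i) s - (((((Λ i s : lorentzGroup) : E4 ≃L[ℝ] E4) (E4.basisVector 0)) 0)⁻¹ • E4.spatial (((Λ i s : lorentzGroup) : E4 ≃L[ℝ] E4) (E4.basisVector 0))))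 t) atTop (𝓝 0) ∧ (a i ≠ 0 → Tendsto (fun t ↦ iteratedDeriv 1 (fun s ↦ (((Λ i s : lorentzGroup) : E4 ≃L[ℝ] E4) (E4.basisVector 3))) t) atTop (𝓝 0))) → (∀ i : Fin N, (Tendsto (fun t ↦ iteratedDeriv 2 (fun s ↦ (((Λ i s : lorentzGroup) : E4 ≃L[ℝ] E4) (E4.basisVector 0))) t) atTop (𝓝 0) ∧ Tendsto (fun t ↦ iteratedDeriv 3 (fun s ↦ (((Λ i s : lorentzGroup) : E4 ≃L[ℝ] E4) (E4.basisVector 0))) t) atTop (𝓝 0)) ∧ (Tendsto (fun t ↦ iteratedDeriv 1 (fun s ↦ deriv (ξ i) s - (((((Λ i s : lorentzGroup) : E4 ≃L[ℝ] E4) (E4.basisVector 0)) 0)⁻¹ • E4.spatial (((Λ i s : lorentzGroup) : E4 ≃L[ℝ] E4) (E4.basisVector 0)))) t) atTop (𝓝 0) ∧ Tendsto (fun t ↦ iteratedDeriv 2 (fun s ↦ deriv (ξ i) s - (((((Λ i s : lorentzGroup) : E4 ≃L[ℝ] E4) (E4.basisVector 0)) 0)⁻¹ • E4.spatial (((Λ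 i s : lorentzGroup) : E4 ≃L[ℝ] E4) (E4.basisVector 0)))) t) atTop (𝓝 0)) ∧ (a i ≠ 0 → Tendsto (fun t ↦ iteratedDeriv 2 (fun s ↦ (((Λ i s : lorentzGroup) : E4 ≃L[ℝ] E4) (E4.basisVector 3))) t) atTop (𝓝 0) ∧ Tendsto (fun t ↦ iteratedDeriv 3 (fun s ↦ (((Λ i s : lorentzGroup) : E4 ≃L[ℝ] E4) (E4.basisVector 3))) t) atTop (𝓝 0))) :=
  -- LANDED (p158971): cited without `sorry`
  Summit.FinalStateConjecture.FinalStateConjecture.Theorems.SublinearIsFree.Slaving.stub_higherOrderSlaving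

/-- **FVS · FROZEN-VACUUM SLAVING** (registered r12b; since r13 PROVED from the seven stubs above — pure
logic plus the landed `C²`/`C³` capstone `exists_relRicci_of_frozenVacuum`, …StubSlaving12RelRicciC3).
Pure analysis on `E4`, no development, no chart: for every `N`, painted moduli with sub-extremal parameters and
`r₋ < rinᵢ < r₊`, Lorentz factors `≤ γ`, smooth motions and separating centres, and EVERY field `e` with (V)
`e + g₀` vacuum metric components on every late hole-following tube with floor `≥ rinᵢ` and (S) `C³`-small on
the core-free late slabs, the third-order slaving block SLAVED³ holds. [folklore] -/
theorem stub_frozenVacuumSlaving :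
    ∀ (N : ℕ) (M a rin : Fin N → ℝ) (Λ : Fin N → ℝ → lorentzGroup) (ξ : Fin N → ℝ → E3) (γ : ℝ) (e : E4 → E4 →L[ℝ] E4 →L[ℝ] ℝ), (∀ i, Kerr.IsSubextremal (M i) (a i) ∧ Kerr.rMinus (M i) (a i) < rin i ∧ rin i < Kerr.rPlus (M i) (a i)) → (∀ i t, |((Λ i t : E4 ≃L[ℝ] E4) (E4.basisVector 0)) 0| ≤ γ) → (∀ i, ContDiff ℝ ((⊤ : ℕ∞) : WithTop ℕ∞) (ξ i) ∧ ContDiff ℝ ((⊤ : ℕ∞) : WithTop ℕ∞) (fun t ↦ ((Λ i t : E4 ≃L[ℝ] E4) : E4 →L[ℝ] E4))) → (∀ i j, i ≠ j → Tendsto (fun t ↦ ‖ξ i t - ξ j t‖) atTop atTop) → (∀ (i : Fin N) (R r₀ : ℝ), rin i ≤ r₀ → ∃ T : ℝ, MetricCoord.IsMetricOn (fun z : E4 ↦ e z + (Minkowski.bilin + ∑ i, (boostedKerrBilin (Λ i (z 0)) (E4.ofTimeSpace (z 0) (ξ i (z 0))) (M i) (a i) z - Minkowski.bilin))) {x : E4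 | T < x 0 ∧ ‖E4.spatial x - ξ i (x 0)‖ < R ∧ r₀ < Kerr.radius (a i) (poincareInv (Λ i (x 0)) (E4.ofTimeSpace (x 0) (ξ i (x 0))) x)} ∧ ∀ x : E4, T < x 0 → ‖E4.spatial x - ξ i (x 0)‖ < R → r₀ < Kerr.radius (a i) (poincareInv (Λ i (x 0)) (E4.ofTimeSpace (x 0) (ξ i (x 0))) x) → (∀ j, rin j < Kerr.radius (a j) (poincareInv (Λ j (x 0)) (E4.ofTimeSpace (x 0) (ξ j (x 0))) x)) ∧ MetricCoord.ricAt (fun z : E4 ↦ e z + (Minkowski.bilin + ∑ i, (boostedKerrBilin (Λ i (z 0)) (E4.ofTimeSpace (z 0) (ξ i (z 0))) (M i) (a i) z - Minkowski.bilin))) x = 0) → Tendsto (fun t : ℝ ↦ supCkENorm {x : E4 | x 0 = t ∧ ∀ j, rin j < Kerr.radius (a j) (poincareInv (Λ j (x 0)) (E4.ofTimeSpace (x 0) (ξ j (x 0))) x)} 3 e) atTop (𝓝 0) → (∀ i : Fin N, (∀ m : ℕ, 1 ≤ m → m ≤ 3 → Tendsto (fun t ↦ iteratedDeriv m (fun s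 ↦ (((Λ i s : lorentzGroup) : E4 ≃L[ℝ] E4) (E4.basisVector 0))) t) atTop (𝓝 0)) ∧ (∀ m : ℕ, m ≤ 2 → Tendsto (fun t ↦ iteratedDeriv m (fun s ↦ deriv (ξ i) s - (((((Λ i s : lorentzGroup) : E4 ≃L[ℝ] E4) (E4.basisVector 0)) 0)⁻¹ • E4.spatial (((Λ i s : lorentzGroup) : E4 ≃L[ℝ] E4) (E4.basisVector 0)))) t) atTop (𝓝 0)) ∧ (a i ≠ 0 → ∀ m : ℕ, 1 ≤ m → m ≤ 3 → Tendsto (fun t ↦ iteratedDeriv m (fun s ↦ (((Λ i s : lorentzGroup) : E4 ≃L[ℝ] E4) (E4.basisVector 3))) t) atTop (𝓝 0))) := by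
  intro N M a rin Λ ξ γ e h1 hγ hsm hsep hV hS
  have hγ1 : ∀ i : Fin N, (1 : ℝ) ≤ γ := fun i ↦
    (Summit.FinalStateConjecture.FinalStateConjecture.Theorems.one_le_abs_lorentz_apply_zero (Λ i 0)).trans (hγ i 0)
  have hML := stub_momRowLinear
  have hM := stub_momCapstone N M a rin Λ ξ γ e h1 hγ hsm hsep hV hS hML
  have hRR : (∀ (i : Fin N) (R r₀ : ℝ), rin i ≤ r₀ → ∀ ε : ℝ, 0 < ε → ∃ T : ℝ, ∀ x : E4, T < x 0 → ‖E4.spatial x - ξ i (x 0)‖ < R → r₀ < Kerr.radius (a i) (poincareInv (Λ i (x 0)) (E4.ofTimeSpace (x 0) (ξ i (x 0))) x) → ∀ l : ℝ, 1 ≤ l → ‖fderiv ℝ (fun z : E4 ↦ Minkowski.bilin + ∑ i, (boostedKerrBilin (Λ i (z 0)) (E4.ofTimeSpace (z 0) (ξ i (z 0))) (M i) (a i) z - Minkowski.bilin)) x‖ ≤ l → ‖fderiv ℝ (fderiv ℝ (fun z : E4 ↦ Minkowski.bilin + ∑ i, (boostedKerrBilin (Λ i (z 0)) (E4.ofTimeSpace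 (z 0) (ξ i (z 0))) (M i) (a i) z - Minkowski.bilin))) x‖ ≤ l ^ 2 → ‖MetricCoord.ricAt (fun z : E4 ↦ Minkowski.bilin + ∑ i, (boostedKerrBilin (Λ i (z 0)) (E4.ofTimeSpace (z 0) (ξ i (z 0))) (M i) (a i) z - Minkowski.bilin)) x‖ ≤ ε * l ^ 2 ∧ (‖fderiv ℝ (fderiv ℝ (fderiv ℝ (fun z : E4 ↦ Minkowski.bilin + ∑ i, (boostedKerrBilin (Λ i (z 0)) (E4.ofTimeSpace (z 0) (ξ i (z 0))) (M i) (a i) z - Minkowski.bilin)))) x‖ ≤ l ^ 3 → ‖fderiv ℝ (MetricCoord.ricAt (fun z : E4 ↦ Minkowski.bilin + ∑ i, (boostedKerrBilin (Λ i (z 0)) (E4.ofTimeSpace (z 0) (ξ i (z 0))) (M i) (a i) z - Minkowski.bilin))) x‖ ≤ ε * l ^ 3)) := fun i R r₀ hr₀ ε hε ↦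
    Summit.FinalStateConjecture.FinalStateConjecture.Theorems.SublinearIsFree.Slaving.exists_relRicci_of_frozenVacuum
      h1 hγ hsm hsep hV hS i R r₀ hr₀ hε
  have hBs : ∀ i : Fin N, (∃ c ρin ρout η₀ : ℝ, 0 < c ∧ 0 < η₀ ∧ 0 < ρin ∧ ρin ≤ ρout ∧ (∀ (L : lorentzGroup) (y : E3), |((L : E4 ≃L[ℝ] E4) (E4.basisVector 0)) 0| ≤ γ → ρin ≤ ‖y‖ → 2 * (M i) < Kerr.radius (a i) (poincareInv L 0 (E4.ofTimeSpace 0 y))) ∧ ∀ (L : lorentzGroup) (A : E4 →L[ℝ] E4) (d : E4) (G : E4 → E4 →L[ℝ] E4 →L[ℝ] ℝ) (V : Set E4), |((L : E4 ≃L[ℝ] E4) (E4.basisVector 0)) 0| ≤ γ → (∀ u w : E4, Minkowski.bilin (A u) w + Minkowski.bilin u (A w) = 0) → MetricCoord.IsMetricOn G V → (∀ y : E3, ρin ≤ ‖y‖ → ‖y‖ ≤ ρout → (E4.ofTimeSpace 0 y) ∈ V ∧ ‖G (E4.ofTimeSpace 0 y) - boostedKerrBilin L 0 (M i) (a i) (E4.ofTimeSpace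 0 y)‖ ≤ η₀ ∧ ‖fderiv ℝ G (E4.ofTimeSpace 0 y) - fderiv ℝ (boostedKerrBilin L 0 (M i) (a i)) (E4.ofTimeSpace 0 y)‖ ≤ η₀ ∧ ‖fderiv ℝ (fderiv ℝ G) (E4.ofTimeSpace 0 y) - fderiv ℝ (fderiv ℝ (boostedKerrBilin L 0 (M i) (a i))) (E4.ofTimeSpace 0 y)‖ ≤ η₀) → ∃ y : E3, ρin ≤ ‖y‖ ∧ ‖y‖ ≤ ρout ∧ c * (‖A (E4.basisVector 0)‖ + ‖E4.spatial d‖ + ‖(a i) • A (E4.basisVector 3)‖) ≤ ∑ j : Fin 3, |MetricCoord.ricAt (fun z : E4 ↦ G z + (z 0) • ((fderiv ℝ (Kerr.bilin (M i) (a i)) (poincareInv L 0 z) (A (poincareInv L 0 z) + d)).bilinearComp (((L : E4 ≃L[ℝ] E4).symm : E4 →L[ℝ] E4)) (((L : E4 ≃L[ℝ] E4).symm : E4 →L[ℝ] E4)) + (Kerr.bilin (M i) (a i) (poincareInv L 0 z)).bilinearComp (A.comp (((L : E4 ≃L[ℝ] E4).symm : E4 →L[ℝ] E4))) (((L : E4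 ≃L[ℝ] E4).symm : E4 →L[ℝ] E4)) + (Kerr.bilin (M i) (a i) (poincareInv L 0 z)).bilinearComp (((L : E4 ≃L[ℝ] E4).symm : E4 →L[ℝ] E4)) (A.comp (((L : E4 ≃L[ℝ] E4).symm : E4 →L[ℝ] E4))))) (E4.ofTimeSpace 0 y) (MetricCoord.sharpAt G (E4.ofTimeSpace 0 y) (E4.dx 0)) (E4.basisVector j.succ) - MetricCoord.ricAt G (E4.ofTimeSpace 0 y) (MetricCoord.sharpAt G (E4.ofTimeSpace 0 y) (E4.dx 0)) (E4.basisVector j.succ)|) := fun i ↦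
    stub_coerMomQuant (M i) (a i) γ (h1 i).1 (hγ1 i) hML stub_coerMomKernel
  have hC : ∀ i : Fin N, (∃ c ρin ρout η₀ : ℝ, 0 < c ∧ 0 < η₀ ∧ 0 < ρin ∧ ρin ≤ ρout ∧ (∀ (L : lorentzGroup) (y : E3), |((L : E4 ≃L[ℝ] E4) (E4.basisVector 0)) 0| ≤ γ → ρin ≤ ‖y‖ → 2 * (M i) < Kerr.radius (a i) (poincareInv L 0 (E4.ofTimeSpace 0 y))) ∧ ∀ (L : lorentzGroup) (A : E4 →L[ℝ] E4) (d : E4) (G G' : E4 → E4 →L[ℝ] E4 →L[ℝ] ℝ) (V : Set E4), |((L : E4 ≃L[ℝ] E4) (E4.basisVector 0)) 0| ≤ γ → (∀ u w : E4, Minkowski.bilin (A u) w + Minkowski.bilin u (A w) = 0) → MetricCoord.IsMetricOn G V → MetricCoord.IsMetricOn G' V → (∀ y : E3, ρin ≤ ‖y‖ → ‖y‖ ≤ ρout → (E4.ofTimeSpace 0 y) ∈ V ∧ ‖G (E4.ofTimeSpace 0 y) - boostedKerrBilin L 0 (M i) (a i) (E4.ofTimeSpace 0 y)‖ ≤ η₀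 ∧ G' (E4.ofTimeSpace 0 y) = G (E4.ofTimeSpace 0 y) ∧ fderiv ℝ G' (E4.ofTimeSpace 0 y) = fderiv ℝ G (E4.ofTimeSpace 0 y) ∧ ∀ v : E4, fderiv ℝ (fderiv ℝ G') (E4.ofTimeSpace 0 y) v = fderiv ℝ (fderiv ℝ G) (E4.ofTimeSpace 0 y) v + (v 0) • (E4.dx 0).smulRight ((fderiv ℝ (Kerr.bilin (M i) (a i)) (poincareInv L 0 (E4.ofTimeSpace 0 y)) (A (poincareInv L 0 (E4.ofTimeSpace 0 y)) + d)).bilinearComp (((L : E4 ≃L[ℝ] E4).symm : E4 →L[ℝ] E4)) (((L : E4 ≃L[ℝ] E4).symm : E4 →L[ℝ] E4)) + (Kerr.bilin (M i) (a i) (poincareInv L 0 (E4.ofTimeSpace 0 y))).bilinearComp (A.comp (((L : E4 ≃L[ℝ] E4).symm : E4 →L[ℝ] E4))) (((L : E4 ≃L[ℝ] E4).symm : E4 →L[ℝ] E4)) + (Kerr.bilin (M i) (a i) (poincareInv L 0 (E4.ofTimeSpace 0 y))).bilinearComp (((L : E4 ≃L[ℝ] E4).symm : E4 →L[ℝ]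 E4)) (A.comp (((L : E4 ≃L[ℝ] E4).symm : E4 →L[ℝ] E4))))) → ∃ y : E3, ρin ≤ ‖y‖ ∧ ‖y‖ ≤ ρout ∧ c * (‖A (E4.basisVector 0)‖ + ‖E4.spatial d‖ + ‖(a i) • A (E4.basisVector 3)‖) ≤ ‖MetricCoord.ricAt G' (E4.ofTimeSpace 0 y) - MetricCoord.ricAt G (E4.ofTimeSpace 0 y)‖) := fun i ↦
    stub_coerSymbolQuant (M i) (a i) γ (h1 i).1 (hγ1 i)
  have hfirst := stub_firstOrderSlaving N M a rin Λ ξ γ h1 hγ hsm hsep hML hBs hM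
  have hhigh := stub_higherOrderSlaving N M a rin Λ ξ γ h1 hγ hsm hsep hC hRR hfirst
  intro i
  obtain ⟨hu1, hm0, hn1⟩ := hfirst i
  obtain ⟨⟨hu2, hu3⟩, ⟨hm1, hm2⟩, hn23⟩ := hhigh i
  refine ⟨fun m hm hm' ↦ ?_, fun m hm ↦ ?_, fun ha m hm hm' ↦ ?_⟩
  · interval_cases m <;> assumption
  · interval_cases m <;> assumption
  · obtain ⟨hn2, hn3⟩ := hn23 ha
    interval_cases m
    · exact hn1 ha
    · exact hn2
    · exact hn3


/-- **K1 · SLAVING, third order (modulo the Kerr–Schild stabiliser), plus painted-velocity kinematics** (r11 verbatim; since r12b a CITATION of w-slaving's reduction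
`stub_slaving_of_frozenVacuumSlaving` applied to `stub_frozenVacuumSlaving`). Under the (old, twelve-clause) antecedent block, for every hole `i`: the painted 4-velocity `uᵢ(t) = Λᵢ(t)e₀` has lab-time derivatives of orders
`1, 2, 3` tending to `0`; the centre mismatch `ξ̇ᵢ(t) − v(Λᵢ(t))`, `v(Λ) = (Λe₀)̲/(Λe₀)⁰`, and its first two derivatives tend to `0`; when
`aᵢ ≠ 0` the painted axis `Λᵢ(t)e₃` has derivatives of orders `1, 2, 3` tending to `0` (nothing about `deriv Λᵢ` itself —
`Negative/PaintingRigidityStabiliser`). Mechanism: `Ric(Φ^*g) = 0` and `C³`-closeness on whole lab slabs reaching inside the horizons give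
`Ric(G(λ(·))) → 0` in `C¹` on each near annulus; tidal part `O(Mⱼ/Dᵢⱼ) → 0`; the remainder is linear in the parameter jet with explicit
Kerr–Schild coefficient fields, injective modulo the Killing directions (COER: full rank verified in exact arithmetic), after an a-priori
bound on the jet from the `m ≤ 3` clauses. KINEMATICS: `t ↦ v(Λᵢ(t))` continuous and `‖v(Λᵢ(t))‖ ≤ k := √(1 − γ⁻²) < 1`. Landed parts:
`Theorems.…StubSlaving3ZeroSet` (F1, all spins), `…RicciNearHole`, jet-sharp Ricci perturbation, jet scaling, far field (a = 0), dilation;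
remaining = COER + assembly. Size L/XL. [arXiv:0806.3293; LL §96; landed `Theorems.EIHFluxBalanceInertialRecessionLorentz`] -/
theorem stub_slaving : ∀ (X : Type) [TopologicalSpace X] [ChartedSpace E3 X] [IsManifold (𝓡 3) ((⊤ : ℕ∞) : WithTop ℕ∞) X] [T2Space X] [SecondCountableTopology X] [ConnectedSpace X], ∀ D ∈ admissibleVacuumData X, ∀ 𝒟 : VacuumCauchyDevelopment D, 𝒟.IsMaximal → ∀ (N : ℕ) (M a rin : Fin N → ℝ) (Λ : Fin N → ℝ → lorentzGroup) (ξ : Fin N → ℝ → E3) (γ κ τ₀ : ℝ) (U : Opens E4) (Φ : U → 𝒟.carrier) (O : Set 𝒟.carrier), ((∀ i, Kerr.IsSubextremal (M i) (a i) ∧ Kerr.rMinus (M i) (a i) < rin i ∧ rin i < Kerr.rPlus (M i) (a i)) ∧ (∀ i t, |((Λ i t : E4 ≃L[ℝ] E4) (E4.basisVector 0)) 0| ≤ γ) ∧ (∀ i, ContDiff ℝ ((⊤ : ℕ∞) : WithTop ℕ∞) (ξ i) ∧ ContDiff ℝ ((⊤ : ℕ∞) : WithTop ℕ∞) (fun t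 ↦ ((Λ i t : E4 ≃L[ℝ] E4) : E4 →L[ℝ] E4))) ∧ (∀ i j, i ≠ j → Tendsto (fun t ↦ ‖ξ i t - ξ j t‖) atTop atTop) ∧ (0 < κ ∧ κ < 1 ∧ ∀ i, ∀ᶠ t in atTop, ‖ξ i t‖ ≤ κ ^ 2 * t) ∧ ({x : E4 | τ₀ < x 0 ∧ ∀ i, rin i < Kerr.radius (a i) (poincareInv (Λ i (x 0)) (E4.ofTimeSpace (x 0) (ξ i (x 0))) x)} ⊆ (U : Set E4)) ∧ let B : ModelBackground := ⟨U, fun x ↦ Minkowski.bilin + ∑ i, (boostedKerrBilin (Λ i (x 0)) (E4.ofTimeSpace (x 0) (ξ i (x 0))) (M i) (a i) x - Minkowski.bilin), fun x ↦ x 0, E4.spatialNorm⟩; ContMDiff 𝓘(ℝ, E4) (𝓡 4) ((⊤ : ℕ∞) : WithTop ℕ∞) Φ ∧ Topology.IsOpenEmbedding ((B.lateRegion τ₀).restrict Φ) ∧ Φ '' {x : U | τ₀ < x.1 0 ∧ ∀ i, Kerr.rPlus (M i) (a i) < Kerr.radius (a i) (poincareInv (Λ i (x.1 0)) (E4.ofTimeSpace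 (x.1 0) (ξ i (x.1 0))) x.1)} ⊆ O ∧ Tendsto (fun t ↦ 𝒟.toSpacetime.deviationCk B Φ 3 t) atTop (𝓝 0) ∧ Tendsto (fun t : ℝ ↦ ⨆ x ∈ {x : U | x.1 0 = t ∧ E4.spatialNorm x.1 ≤ κ * t}, ⨆ (m : ℕ) (_ : m ≤ 3), ENNReal.ofReal (1 + √(√((⨅ i, ‖E4.spatial x.1 - ξ i t‖) ^ 7))) * ‖iteratedFDeriv ℝ m (𝒟.toSpacetime.deviationExtend B Φ) x.1‖ₑ) atTop (𝓝 0) ∧ O = Summit.FinalStateConjecture.exteriorOf 𝒟.toCauchyDevelopment (Φ '' {x : U | τ₀ < x.1 0 ∧ ∀ i, Kerr.rPlus (M i) (a i) < Kerr.radius (a i) (poincareInv (Λ i (x.1 0)) (E4.ofTimeSpace (x.1 0) (ξ i (x.1 0))) x.1)}) ∧ ∀ t₁ : ℝ, τ₀ < t₁ → O \ Φ '' {x : U | t₁ < x.1 0 ∧ ∀ i, Kerr.rPlus (M i) (a i) < Kerr.radius (a i) (poincareInv (Λ i (x.1 0)) (E4.ofTimeSpace (x.1 0) (ξ i (x.1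 0))) x.1)} ⊆ 𝒟.metric.causalPast 𝒟.timeOrientation (Φ '' {x : U | x.1 0 = t₁ ∧ ∀ i, Kerr.rPlus (M i) (a i) < Kerr.radius (a i) (poincareInv (Λ i (x.1 0)) (E4.ofTimeSpace (x.1 0) (ξ i (x.1 0))) x.1)})) →
    (∀ i : Fin N, (∀ m : ℕ, 1 ≤ m → m ≤ 3 → Tendsto (fun t ↦ iteratedDeriv m (fun s ↦ (((Λ i s : lorentzGroup) : E4 ≃L[ℝ] E4) (E4.basisVector 0))) t) atTop (𝓝 0)) ∧ (∀ m : ℕ, m ≤ 2 → Tendsto (fun t ↦ iteratedDeriv m (fun s ↦ deriv (ξ i) s - (((((Λ i s : lorentzGroup) : E4 ≃L[ℝ] E4) (E4.basisVector 0)) 0)⁻¹ • E4.spatial (((Λ i s : lorentzGroup) : E4 ≃L[ℝ] E4) (E4.basisVector 0)))) t) atTop (𝓝 0)) ∧ (a i ≠ 0 → ∀ m : ℕ, 1 ≤ m → m ≤ 3 → Tendsto (fun t ↦ iteratedDeriv m (fun s ↦ (((Λ i s : lorentzGroup) : E4 ≃L[ℝ] E4) (E4.basisVector 3))) t) atTop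 (𝓝 0))) ∧
    ((∀ i : Fin N, Continuous (fun t ↦ (((((Λ i t : lorentzGroup) : E4 ≃L[ℝ] E4) (E4.basisVector 0)) 0)⁻¹ • E4.spatial (((Λ i t : lorentzGroup) : E4 ≃L[ℝ] E4) (E4.basisVector 0))))) ∧ (∃ k : ℝ, 0 ≤ k ∧ k < 1 ∧ ∀ (i : Fin N) (t : ℝ), ‖(((((Λ i t : lorentzGroup) : E4 ≃L[ℝ] E4) (E4.basisVector 0)) 0)⁻¹ • E4.spatial (((Λ i t : lorentzGroup) : E4 ≃L[ℝ] E4) (E4.basisVector 0)))‖ ≤ k)) :=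
  Summit.FinalStateConjecture.FinalStateConjecture.Theorems.SublinearIsFree.Slaving.stub_slaving_of_frozenVacuumSlaving
    stub_frozenVacuumSlaving

/-- **LL · THE DENSITISED LANDAU–LIFSHITZ PSEUDOTENSOR IS QUADRATIC IN FIRST DERIVATIVES** (bound form of LL (96.8)/(96.9)): for metric
components `g` of class `C²` at `x`, symmetric near `x`, with `‖g(x) − η‖ ≤ 1/2`, `|(−g)(x) t^{μν}_LL(x)| ≤ C‖Dg(x)‖²` with ONE universal `C`.
PROVED (r8): `Theorems.…StubPseudotensorBound.stub_pseudotensorBound` (p91215, `C = 7713792`); cited here without `sorry`.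
[cite: LandauLifshitz1975, §96 (96.8)–(96.9)] -/
theorem stub_pseudotensorBound :
    (∃ C : ℝ, 0 ≤ C ∧ ∀ (g : E4 → E4 →L[ℝ] E4 →L[ℝ] ℝ) (x : E4) (b : ℝ), ContDiffAt ℝ 2 g x → (∀ᶠ y in 𝓝 x, ∀ v w : E4, g y v w = g y w v) → ‖g x - Minkowski.bilin‖ ≤ 1 / 2 → (∀ v : E4, ‖fderiv ℝ g x v‖ ≤ b * ‖v‖) → ∀ μ ν : Fin 4, |LandauLifshitz.metricDet g x * LandauLifshitz.pseudotensor g x μ ν| ≤ C * b ^ 2) :=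
  Summit.FinalStateConjecture.FinalStateConjecture.Theorems.SublinearIsFree.PseudotensorBound.stub_pseudotensorBound

/-- **EXC · CLEAN EXCISION WITH A RATE IN SCALE for the lab charges** (the line's GR stub; hypotheses verbatim those of the PROVED
identification `Theorems.…StubIdentificationMain.cleanWindowCharges_identification`: pseudotensor bound, antecedent block, `0 < N`, Slaved³,
QS). At EQUAL TIMES, for a δ-admissible window `(c,R)` in the middle cone and a finite family of δ-admissible sub-windows `(c′ₖ,R′ₖ)`
nested in it (`‖c′ₖ − c‖ + (1+δ)R′ₖ ≤ (1−δ)R`), pairwise `(1+δ)`-separated, every radius `≥ Rm ≥ ρ(t)/δ`, carrying all members of the big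
window: `|P(t;c,R) − Σₖ P(t;c′ₖ,R′ₖ)| ≤ C·Rm^{-1/2}` for the Landau–Lifshitz charges `P := quasiLocalMomentum (G(λ(x⁰)) + deviationExtend)`
of the TRUE lab metric. Proof route: the perforated region `K = B(c,R) ∖ ⋃ B(c′ₖ,R′ₖ)` is `δRm`-clear of every painted centre and inside
`‖y‖ ≤ (κ+κ²)t/2`; `LLGauss.perforatedGauss_law` (exact, any radii) + `shellGaussLaw_vacuum` (bulk `= (−g)t^{μ0}_LL` where `Ric(Φ^*g)=0`,
the Ricci bridge of the identification) + `abs_emComplex_le_of_pseudotensorBound` + `lab_sphereConditions` (`‖∂(labMetric)‖ ≤ K d^{-7/4}`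
at clean late cone points — consumes QS) + `ll_bulk_decay_bound` (`|∫_K F| ≤ L·N·8π/√ρ₀` when `|F| ≤ LΣ‖y − ξᵢ‖^{-7/2}` on a `ρ₀`-clear
set) give `C = C_PTB K² N 8π δ^{-1/2}`. Size S/M. [LL §96 (96.16); arXiv:1310.1528 §2; card clean-excision-has-a-rate] -/
theorem stub_cleanExcision :
        (∃ C : ℝ, 0 ≤ C ∧ ∀ (g : E4 → E4 →L[ℝ] E4 →L[ℝ] ℝ) (x : E4) (b : ℝ), ContDiffAt ℝ 2 g x → (∀ᶠ y in 𝓝 x, ∀ v w : E4, g y v w = g y w v) → ‖g x - Minkowski.bilin‖ ≤ 1 / 2 → (∀ v : E4, ‖fderiv ℝ g x v‖ ≤ b * ‖v‖) → ∀ μ ν : Fin 4, |LandauLifshitz.metricDet g x * LandauLifshitz.pseudotensor g x μ ν| ≤ C * b ^ 2) →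
    ∀ (X : Type) [TopologicalSpace X] [ChartedSpace E3 X] [IsManifold (𝓡 3) ((⊤ : ℕ∞) : WithTop ℕ∞) X] [T2Space X] [SecondCountableTopology X] [ConnectedSpace X], ∀ D ∈ admissibleVacuumData X, ∀ 𝒟 : VacuumCauchyDevelopment D, 𝒟.IsMaximal → ∀ (N : ℕ) (M a rin : Fin N → ℝ) (Λ : Fin N → ℝ → lorentzGroup) (ξ : Fin N → ℝ → E3) (γ κ τ₀ : ℝ) (U : Opens E4) (Φ : U → 𝒟.carrier) (O : Set 𝒟.carrier), ((∀ i, Kerr.IsSubextremal (M i) (a i) ∧ Kerr.rMinus (M i) (a i) < rin i ∧ rin i < Kerr.rPlus (M i) (a i)) ∧ (∀ i t, |((Λ i t : E4 ≃L[ℝ] E4) (E4.basisVector 0)) 0| ≤ γ) ∧ (∀ i, ContDiff ℝ ((⊤ : ℕ∞) : WithTop ℕ∞) (ξ i) ∧ ContDiff ℝ ((⊤ : ℕ∞) : WithTop ℕ∞) (fun t ↦ ((Λ i t : E4 ≃L[ℝ] E4) : E4 →L[ℝ] E4))) ∧ (∀ i j, i ≠ j → Tendsto (fun t ↦ ‖ξ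 i t - ξ j t‖) atTop atTop) ∧ (0 < κ ∧ κ < 1 ∧ ∀ i, ∀ᶠ t in atTop, ‖ξ i t‖ ≤ κ ^ 2 * t) ∧ ({x : E4 | τ₀ < x 0 ∧ ∀ i, rin i < Kerr.radius (a i) (poincareInv (Λ i (x 0)) (E4.ofTimeSpace (x 0) (ξ i (x 0))) x)} ⊆ (U : Set E4)) ∧ let B : ModelBackground := ⟨U, fun x ↦ Minkowski.bilin + ∑ i, (boostedKerrBilin (Λ i (x 0)) (E4.ofTimeSpace (x 0) (ξ i (x 0))) (M i) (a i) x - Minkowski.bilin), fun x ↦ x 0, E4.spatialNorm⟩; ContMDiff 𝓘(ℝ, E4) (𝓡 4) ((⊤ : ℕ∞) : WithTop ℕ∞) Φ ∧ Topology.IsOpenEmbedding ((B.lateRegion τ₀).restrict Φ) ∧ Φ '' {x : U | τ₀ < x.1 0 ∧ ∀ i, Kerr.rPlus (M i) (a i) < Kerr.radius (a i) (poincareInv (Λ i (x.1 0)) (E4.ofTimeSpace (x.1 0) (ξ i (x.1 0))) x.1)} ⊆ O ∧ Tendsto (fun t ↦ 𝒟.toSpacetime.deviationCk B Φ 3 t)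 atTop (𝓝 0) ∧ Tendsto (fun t : ℝ ↦ ⨆ x ∈ {x : U | x.1 0 = t ∧ E4.spatialNorm x.1 ≤ κ * t}, ⨆ (m : ℕ) (_ : m ≤ 3), ENNReal.ofReal (1 + √(√((⨅ i, ‖E4.spatial x.1 - ξ i t‖) ^ 7))) * ‖iteratedFDeriv ℝ m (𝒟.toSpacetime.deviationExtend B Φ) x.1‖ₑ) atTop (𝓝 0) ∧ O = Summit.FinalStateConjecture.exteriorOf 𝒟.toCauchyDevelopment (Φ '' {x : U | τ₀ < x.1 0 ∧ ∀ i, Kerr.rPlus (M i) (a i) < Kerr.radius (a i) (poincareInv (Λ i (x.1 0)) (E4.ofTimeSpace (x.1 0) (ξ i (x.1 0))) x.1)}) ∧ ∀ t₁ : ℝ, τ₀ < t₁ → O \ Φ '' {x : U | t₁ < x.1 0 ∧ ∀ i, Kerr.rPlus (M i) (a i) < Kerr.radius (a i) (poincareInv (Λ i (x.1 0)) (E4.ofTimeSpace (x.1 0) (ξ i (x.1 0))) x.1)} ⊆ 𝒟.metric.causalPast 𝒟.timeOrientation (Φ '' {x : U | x.1 0 = t₁ ∧ ∀ i, Kerr.rPlus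 (M i) (a i) < Kerr.radius (a i) (poincareInv (Λ i (x.1 0)) (E4.ofTimeSpace (x.1 0) (ξ i (x.1 0))) x.1)})) → 0 < N →
    (∀ i : Fin N, (∀ m : ℕ, 1 ≤ m → m ≤ 3 → Tendsto (fun t ↦ iteratedDeriv m (fun s ↦ (((Λ i s : lorentzGroup) : E4 ≃L[ℝ] E4) (E4.basisVector 0))) t) atTop (𝓝 0)) ∧ (∀ m : ℕ, m ≤ 2 → Tendsto (fun t ↦ iteratedDeriv m (fun s ↦ deriv (ξ i) s - (((((Λ i s : lorentzGroup) : E4 ≃L[ℝ] E4) (E4.basisVector 0)) 0)⁻¹ • E4.spatial (((Λ i s : lorentzGroup) : E4 ≃L[ℝ] E4) (E4.basisVector 0)))) t) atTop (𝓝 0)) ∧ (a i ≠ 0 → ∀ m : ℕ, 1 ≤ m → m ≤ 3 → Tendsto (fun t ↦ iteratedDeriv m (fun s ↦ (((Λ i s : lorentzGroup) : E4 ≃L[ℝ] E4) (E4.basisVector 3))) t) atTop (𝓝 0))) →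
    (∀ ρ : ℝ → ℝ, Tendsto ρ atTop atTop → Tendsto (fun t : ℝ ↦ ⨆ x ∈ {x : E4 | x 0 = t ∧ E4.spatialNorm x ≤ κ * t ∧ ρ t ≤ ⨅ i, ‖E4.spatial x - ξ i t‖}, ENNReal.ofReal (1 + √(√((⨅ i, ‖E4.spatial x - ξ i t‖) ^ 7))) * ‖fderiv ℝ (fun y : E4 ↦ Minkowski.bilin + ∑ i, (boostedKerrBilin (Λ i (y 0)) (E4.ofTimeSpace (y 0) (ξ i (y 0))) (M i) (a i) y - Minkowski.bilin)) x (E4.basisVector 0)‖ₑ) atTop (𝓝 0)) →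
    (∀ ρ : ℝ → ℝ, Tendsto ρ atTop atTop → ∀ δ : ℝ, 0 < δ → δ < 1 → ∃ (C T : ℝ), ∀ (t : ℝ) (c : E3) (R Rm : ℝ) (m : ℕ) (c' : Fin m → E3) (R' : Fin m → ℝ), T ≤ t → 0 < Rm → ρ t ≤ δ * Rm → Rm ≤ R → (∀ k, Rm ≤ R' k) → ‖c‖ + R ≤ (κ + κ ^ 2) / 2 * t → (∀ j, ‖ξ j t - c‖ ≤ (1 - δ) * R ∨ (1 + δ) * R ≤ ‖ξ j t - c‖) → (∀ k j, ‖ξ j t - c' k‖ ≤ (1 - δ) * R' k ∨ (1 + δ) * R' k ≤ ‖ξ j t - c' k‖) → (∀ k, ‖c' k - c‖ + (1 + δ) * R' k ≤ (1 - δ) * R) → (∀ k l, k ≠ l → (1 + δ) * (R' k + R' l) ≤ ‖c' k - c' l‖) → (∀ j, ‖ξ j t - c‖ ≤ (1 - δ) * R → ∃ k, ‖ξ j t - c' k‖ ≤ (1 - δ) * R' k) → ∀ μ : Fin 4, |(LandauLifshitz.quasiLocalMomentum (fun x : E4 ↦ (Minkowski.bilin + ∑ i, (boostedKerrBilin (Λ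 i (x 0)) (E4.ofTimeSpace (x 0) (ξ i (x 0))) (M i) (a i) x - Minkowski.bilin)) + 𝒟.toSpacetime.deviationExtend (⟨U, fun x ↦ Minkowski.bilin + ∑ i, (boostedKerrBilin (Λ i (x 0)) (E4.ofTimeSpace (x 0) (ξ i (x 0))) (M i) (a i) x - Minkowski.bilin), fun x ↦ x 0, E4.spatialNorm⟩ : ModelBackground) Φ x)) t c R μ - ∑ k, (LandauLifshitz.quasiLocalMomentum (fun x : E4 ↦ (Minkowski.bilin + ∑ i, (boostedKerrBilin (Λ i (x 0)) (E4.ofTimeSpace (x 0) (ξ i (x 0))) (M i) (a i) x - Minkowski.bilin)) + 𝒟.toSpacetime.deviationExtend (⟨U, fun x ↦ Minkowski.bilin + ∑ i, (boostedKerrBilin (Λ i (x 0)) (E4.ofTimeSpace (x 0) (ξ i (x 0))) (M i) (a i) x - Minkowski.bilin), fun x ↦ x 0, E4.spatialNorm⟩ : ModelBackground) Φ x)) t (c' k) (R' k) μ| ≤ C * (√Rm)⁻¹) :=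
  Summit.FinalStateConjecture.FinalStateConjecture.Theorems.SketchCleanExcision.stub_cleanExcision

/-- **CB · INTEGRATED CLUSTER BALANCE from WINDOW LAW + IDENTIFICATION + CLEAN EXCISION** (the line's defining stub; Mathlib-only).
For the abstract expanding system of charges (centres `ξᵢ` in the cone `κ²t`, pairwise separating, slaved to continuous velocities
`‖vᵢ‖ ≤ k < 1`; charges `P` obeying (WL) the window law along 2-Lipschitz δ-admissible window paths, (ID) identification
`P = Σ_members Mⱼγⱼ(1,vⱼ) ± ζ(t)`, `ζ → 0`, and (EXC) clean excision with a rate in scale, each above any threshold `ρ → ∞`): for every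
member set `S` isolated from its outsiders by set-distance `r(s)` on `[t₁,t₂]` (`r` continuous, positive), the kinematic energy–momentum of
`S` changes by at most `ζ₀(t₁) + C₀∫_{t₁}^{t₂} min(r(s),s)^{-3/2} ds`, `ζ₀ → 0` — NO slowness, NO tightness, NO bound on the number of
re-partitions. Staircase proof: (1) at a gap scale `σ` (one of `N²+1` geometric bands below `min(r, c₀s)/16` contains no pairwise distance of
`S`, so "`d < σ`" is an equivalence on `S` with classes of diameter `< σ`, mutually `≥ 16σ` apart, outsiders `≥ 16σ` away) cover `S` by the
windows `(ξ_{a(p)}, 2σ)`, `2δ`-admissible; (2) hold the cover static for `Δ = δσ/16` (speeds `< 1`): it stays δ-admissible, (WL) with a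
constant path costs `≤ C Δ σ^{-3/2} ≤ C′∫_step min(r,s)^{-3/2}`; (3) re-cover and compare old and new covers through the common refinement at
a gap scale below `δσ_min/8`: (EXC) twice costs `≤ C σ_min^{-1/2} ≤ C″∫_step min(r,s)^{-3/2}` (full steps only); (4) identification only at
`t₁` and `t₂` (`≤ Nζ` each; `ζ₀(t) := 2N sup_{s ≥ t} ζ⁺`). The threshold `ρ` handed to (WL)/(ID)/(EXC) is
`ρ(s) := c_{N,δ} · inf_{s′ ≥ s} min(min_{i≠j}‖ξᵢ−ξⱼ‖(s′), c₀s′) → ∞`. Size L. [card clean-excision-has-a-rate; Dereziński–Gérard 1997 Ch. 5] -/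
theorem stub_integratedClusterBalance :
    ∀ (N : ℕ) (M : Fin N → ℝ) (ξ v : Fin N → ℝ → E3) (κ : ℝ) (P : ℝ → E3 → ℝ → Fin 4 → ℝ), (∀ i, 0 < M i) → 0 < κ → κ < 1 → (∀ i, ContDiff ℝ ((⊤ : ℕ∞) : WithTop ℕ∞) (ξ i)) → (∀ i, ∀ᶠ t in atTop, ‖ξ i t‖ ≤ κ ^ 2 * t) → (∀ i j, i ≠ j → Tendsto (fun t ↦ ‖ξ i t - ξ j t‖) atTop atTop) → (∀ i, Continuous (v i)) → (∃ k : ℝ, 0 ≤ k ∧ k < 1 ∧ ∀ i t, ‖v i t‖ ≤ k) → (∀ i, Tendsto (fun t ↦ deriv (ξ i) t - v i t) atTop (𝓝 0)) → (∀ ρ : ℝ → ℝ, Tendsto ρ atTop atTop → ∀ δ : ℝ, 0 < δ → δ < 1 → ∃ (C T : ℝ), ∀ (t₁ t₂ : ℝ) (c : ℝ → E3) (R : ℝ → ℝ), T ≤ t₁ → t₁ ≤ t₂ → (∀ s ∈ Set.Icc t₁ t₂, ∀ s' ∈ Set.Icc t₁ t₂, ‖c s - c s'‖ ≤ 2 *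 |s - s'| ∧ |R s - R s'| ≤ 2 * |s - s'|) → (∀ s ∈ Set.Icc t₁ t₂, ρ s ≤ δ * R s ∧ ‖c s‖ + R s ≤ (κ + κ ^ 2) / 2 * s ∧ ∀ j, ‖ξ j s - c s‖ ≤ (1 - δ) * R s ∨ (1 + δ) * R s ≤ ‖ξ j s - c s‖) → ∀ μ : Fin 4, |P t₂ (c t₂) (R t₂) μ - P t₁ (c t₁) (R t₁) μ| ≤ C * ∫ s in t₁..t₂, (R s ^ (3 / 2 : ℝ))⁻¹) → (∀ ρ : ℝ → ℝ, Tendsto ρ atTop atTop → ∀ δ : ℝ, 0 < δ → δ < 1 → ∃ (T : ℝ) (ζ : ℝ → ℝ), Tendsto ζ atTop (𝓝 0) ∧ ∀ (t : ℝ) (c : E3) (R : ℝ) (A : Finset (Fin N)), T ≤ t → ρ t ≤ δ * R → ‖c‖ + R ≤ (κ + κ ^ 2) / 2 * t → (∀ j, ‖ξ j t - c‖ ≤ (1 - δ) * R ∨ (1 + δ) * R ≤ ‖ξ j t - c‖) → (∀ j, j ∈ A ↔ ‖ξ j t - c‖ ≤ (1 - δ) * R) → |P t c R 0 - ∑ j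 ∈ A, M j * (√(1 - ‖v j t‖ ^ 2))⁻¹| ≤ ζ t ∧ ∀ k : Fin 3, |P t c R k.succ - ∑ j ∈ A, M j * (√(1 - ‖v j t‖ ^ 2))⁻¹ * v j t k| ≤ ζ t) → (∀ ρ : ℝ → ℝ, Tendsto ρ atTop atTop → ∀ δ : ℝ, 0 < δ → δ < 1 → ∃ (C T : ℝ), ∀ (t : ℝ) (c : E3) (R Rm : ℝ) (m : ℕ) (c' : Fin m → E3) (R' : Fin m → ℝ), T ≤ t → 0 < Rm → ρ t ≤ δ * Rm → Rm ≤ R → (∀ k, Rm ≤ R' k) → ‖c‖ + R ≤ (κ + κ ^ 2) / 2 * t → (∀ j, ‖ξ j t - c‖ ≤ (1 - δ) * R ∨ (1 + δ) * R ≤ ‖ξ j t - c‖) → (∀ k j, ‖ξ j t - c' k‖ ≤ (1 - δ) * R' k ∨ (1 + δ) * R' k ≤ ‖ξ j t - c' k‖) → (∀ k, ‖c' k - c‖ + (1 + δ) * R' k ≤ (1 - δ) * R) → (∀ k l, k ≠ l → (1 + δ) * (R' k + R' l) ≤ ‖c' k - c' l‖) → (∀ j, ‖ξ j t - c‖ ≤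 (1 - δ) * R → ∃ k, ‖ξ j t - c' k‖ ≤ (1 - δ) * R' k) → ∀ μ : Fin 4, |P t c R μ - ∑ k, P t (c' k) (R' k) μ| ≤ C * (√Rm)⁻¹) → ∃ (C₀ T₀ : ℝ) (ζ₀ : ℝ → ℝ), Tendsto ζ₀ atTop (𝓝 0) ∧ ∀ (S : Finset (Fin N)) (t₁ t₂ : ℝ) (r : ℝ → ℝ), T₀ ≤ t₁ → t₁ ≤ t₂ → S.Nonempty → ContinuousOn r (Set.Icc t₁ t₂) → (∀ s ∈ Set.Icc t₁ t₂, 0 < r s ∧ ∀ i ∈ S, ∀ j ∉ S, r s ≤ ‖ξ i s - ξ j s‖) → ‖∑ j ∈ S, (M j * (√(1 - ‖v j t₂‖ ^ 2))⁻¹) • v j t₂ - ∑ j ∈ S, (M j * (√(1 - ‖v j t₁‖ ^ 2))⁻¹) • v j t₁‖ ≤ ζ₀ t₁ + C₀ * ∫ s in t₁..t₂, ((min (r s) s) ^ (3 / 2 : ℝ))⁻¹ ∧ |∑ j ∈ S, M j * (√(1 - ‖v j t₂‖ ^ 2))⁻¹ - ∑ j ∈ S, M j * (√(1 - ‖v j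 t₁‖ ^ 2))⁻¹| ≤ ζ₀ t₁ + C₀ * ∫ s in t₁..t₂, ((min (r s) s) ^ (3 / 2 : ℝ))⁻¹ :=
  Summit.FinalStateConjecture.FinalStateConjecture.Theorems.SublinearIsFree.Staircase.stub_integratedClusterBalance

/-- **OR · THE INCREMENT ORACLE from the integrated cluster balance** (Mathlib-only; conclusion = r11's ORACLE(Q) verbatim, consumed
by the landed `Theorems.…StubEndgameOracleTop.tendsto_velocity_of_oracle`). Ballistic (member, outsider) pairs with floor `W/2` and a
fixed unit direction give `‖ξⱼ − ξᵢ‖(s) ≥ max(A₀(s), (W/2)|s − s_{ij}|) ` pairwise after a late time, so with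
`r(s) := min_{i∈S,j∉S} ‖ξᵢ − ξⱼ‖(s)` (continuous, positive) `∫_{t₁}^{t₂} min(r,s)^{-3/2} ≤ 2t₁^{-1/2}·c + N²·2·2√2·8/(W√A₀)` — the landed
`…OracleTightBallistic.integral_radius_le` / `…OracleMixed.integral_radius_le_mixed` — and `A₀ → ∞` (pairwise separation) makes the bound
`≤ Ω` after `T₀(Ω, W_lo)`; the internal-slowness clause `30W/Q` is not used (any `Q ≥ 400` works). Size M. [card clean-excision-has-a-rate] -/
theorem stub_oracleOfClusterBalance :
    ∀ (N : ℕ) (M : Fin N → ℝ) (ξ v : Fin N → ℝ → E3) (κ : ℝ), (∀ i, 0 < M i) → 0 < κ → κ < 1 → (∀ i, ContDiff ℝ ((⊤ : ℕ∞) : WithTop ℕ∞) (ξ i)) → (∀ i, ∀ᶠ t in atTop, ‖ξ i t‖ ≤ κ ^ 2 * t) → (∀ i j, i ≠ j → Tendsto (fun t ↦ ‖ξ i t - ξ j t‖) atTop atTop) → (∀ i, Continuous (v i)) → (∃ k : ℝ, 0 ≤ k ∧ k < 1 ∧ ∀ i t, ‖v i t‖ ≤ k) → (∀ i, Tendsto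 (fun t ↦ deriv (ξ i) t - v i t) atTop (𝓝 0)) → (∃ (C₀ T₀ : ℝ) (ζ₀ : ℝ → ℝ), Tendsto ζ₀ atTop (𝓝 0) ∧ ∀ (S : Finset (Fin N)) (t₁ t₂ : ℝ) (r : ℝ → ℝ), T₀ ≤ t₁ → t₁ ≤ t₂ → S.Nonempty → ContinuousOn r (Set.Icc t₁ t₂) → (∀ s ∈ Set.Icc t₁ t₂, 0 < r s ∧ ∀ i ∈ S, ∀ j ∉ S, r s ≤ ‖ξ i s - ξ j s‖) → ‖∑ j ∈ S, (M j * (√(1 - ‖v j t₂‖ ^ 2))⁻¹) • v j t₂ - ∑ j ∈ S, (M j * (√(1 - ‖v j t₁‖ ^ 2))⁻¹) • v j t₁‖ ≤ ζ₀ t₁ + C₀ * ∫ s in t₁..t₂, ((min (r s) s) ^ (3 / 2 : ℝ))⁻¹ ∧ |∑ j ∈ S, M j * (√(1 - ‖v j t₂‖ ^ 2))⁻¹ - ∑ j ∈ S, M j * (√(1 - ‖v j t₁‖ ^ 2))⁻¹| ≤ ζ₀ t₁ + C₀ * ∫ s in t₁..t₂, ((min (r s) s) ^ (3 / 2 : ℝ))⁻¹)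 → ∃ Q : ℝ, 400 ≤ Q ∧ (∀ Ω : ℝ, 0 < Ω → ∀ Wlo : ℝ, 0 < Wlo → ∃ T₀ : ℝ, ∀ (S : Finset (Fin N)) (t₁ t₂ W : ℝ), T₀ ≤ t₁ → t₁ ≤ t₂ → Wlo ≤ W → S.Nonempty → (∀ s ∈ Set.Icc t₁ t₂, ∀ k ∈ S, ∀ l ∈ S, ‖v k s - v l s‖ ≤ 30 * W / Q) → (∀ i ∈ S, ∀ j ∉ S, ∃ n : E3, ‖n‖ = 1 ∧ ∀ s ∈ Set.Icc t₁ t₂, W / 2 ≤ inner ℝ (deriv (ξ j) s - deriv (ξ i) s) n) → ‖∑ j ∈ S, (M j * (√(1 - ‖v j t₂‖ ^ 2))⁻¹) • v j t₂ - ∑ j ∈ S, (M j * (√(1 - ‖v j t₁‖ ^ 2))⁻¹) • v j t₁‖ ≤ Ω ∧ |∑ j ∈ S, M j * (√(1 - ‖v j t₂‖ ^ 2))⁻¹ - ∑ j ∈ S, M j * (√(1 - ‖v j t₁‖ ^ 2))⁻¹| ≤ Ω) :=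
  Summit.FinalStateConjecture.FinalStateConjecture.Theorems.SublinearIsFree.Oracle.stub_oracleOfClusterBalance

/-- **N0 · THE DISPERSIVE CASE ON THE GIVEN REGION** (`N = 0`; bookkeeping). With no hole the ansatz is Minkowski on `U`; take
`d.τ₀ := τ₀ + 1`, flat domain `U`, flat chart `Φ`, no hole charts; then `d.charted = Φ{x⁰ > τ₀ + 1}` and ON THE GIVEN `O`:
`exteriorOf 𝒟 d.charted ⊆ O` by monotonicity of `I⁻`; conversely the hypothesis' exhaustion clause at `t₁ = τ₀ + 2` puts every point of `O`
in `Φ{x⁰ > τ₀+2} ∪ J⁻(Φ{x⁰ = τ₀+2}) ⊆ J⁻(Φ{x⁰ > τ₀+1}) = I⁻(Φ{x⁰ > τ₀+1})` (open set: `Theorems.causalPast_subset_chronologicalPast_of_isOpen`,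
…StubRechart11Region), so `O = exteriorOf 𝒟 d.charted`; `HasExhaustiveCharts` = the exhaustion clause at `τ₁ > τ₀ + 1` (honest radii vacuous,
`Fin 0`); `IsFutureOriented` (iii): `dΦ(e₀)` is eventually timelike (`C⁰` closeness) and not past-directed by (T) (a past-directed `dΦ(e₀)` at
a late `x` gives `Φ(x − se₀) ∈ J⁺(Φ x)` with smaller lab time; cf. `Theorems.eventually_isFutureDirected_flatChart`, …StubRechart11Orient).
Cf. the landed `Theorems.inertialRecession_noHoles` (old conclusion, smaller region). Size S/M. [O'Neill 1983 Ch. 14; folklore] -/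
theorem stub_noHolesOnRegion : ∀ (X : Type) [TopologicalSpace X] [ChartedSpace E3 X] [IsManifold (𝓡 3) ((⊤ : ℕ∞) : WithTop ℕ∞) X] [T2Space X] [SecondCountableTopology X] [ConnectedSpace X], ∀ D ∈ admissibleVacuumData X, ∀ 𝒟 : VacuumCauchyDevelopment D, 𝒟.IsMaximal → ∀ (N : ℕ) (M a rin : Fin N → ℝ) (Λ : Fin N → ℝ → lorentzGroup) (ξ : Fin N → ℝ → E3) (γ κ τ₀ : ℝ) (U : Opens E4) (Φ : U → 𝒟.carrier) (O : Set 𝒟.carrier), ((∀ i, Kerr.IsSubextremal (M i) (a i) ∧ Kerr.rMinus (M i) (a i) < rin i ∧ rin i < Kerr.rPlus (M i) (a i)) ∧ (∀ i t, |((Λ i t : E4 ≃L[ℝ] E4) (E4.basisVector 0)) 0| ≤ γ) ∧ (∀ i, ContDiff ℝ ((⊤ : ℕ∞) : WithTop ℕ∞) (ξ i) ∧ ContDiff ℝ ((⊤ : ℕ∞) : WithTop ℕ∞) (fun t ↦ ((Λ i t : E4 ≃L[ℝ] E4) : E4 →L[ℝ] E4))) ∧ (∀ i j, i ≠ j → Tendsto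 (fun t ↦ ‖ξ i t - ξ j t‖) atTop atTop) ∧ (0 < κ ∧ κ < 1 ∧ ∀ i, ∀ᶠ t in atTop, ‖ξ i t‖ ≤ κ ^ 2 * t) ∧ ({x : E4 | τ₀ < x 0 ∧ ∀ i, rin i < Kerr.radius (a i) (poincareInv (Λ i (x 0)) (E4.ofTimeSpace (x 0) (ξ i (x 0))) x)} ⊆ (U : Set E4)) ∧ let B : ModelBackground := ⟨U, fun x ↦ Minkowski.bilin + ∑ i, (boostedKerrBilin (Λ i (x 0)) (E4.ofTimeSpace (x 0) (ξ i (x 0))) (M i) (a i) x - Minkowski.bilin), fun x ↦ x 0, E4.spatialNorm⟩; ContMDiff 𝓘(ℝ, E4) (𝓡 4) ((⊤ : ℕ∞) : WithTop ℕ∞) Φ ∧ Topology.IsOpenEmbedding ((B.lateRegion τ₀).restrict Φ) ∧ Φ '' {x : U | τ₀ < x.1 0 ∧ ∀ i, Kerr.rPlus (M i) (a i) < Kerr.radius (a i) (poincareInv (Λ i (x.1 0)) (E4.ofTimeSpace (x.1 0) (ξ i (x.1 0))) x.1)} ⊆ O ∧ Tendsto (fun t ↦ 𝒟.toSpacetime.deviationCk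 B Φ 3 t) atTop (𝓝 0) ∧ Tendsto (fun t : ℝ ↦ ⨆ x ∈ {x : U | x.1 0 = t ∧ E4.spatialNorm x.1 ≤ κ * t}, ⨆ (m : ℕ) (_ : m ≤ 3), ENNReal.ofReal (1 + √(√((⨅ i, ‖E4.spatial x.1 - ξ i t‖) ^ 7))) * ‖iteratedFDeriv ℝ m (𝒟.toSpacetime.deviationExtend B Φ) x.1‖ₑ) atTop (𝓝 0) ∧ O = Summit.FinalStateConjecture.exteriorOf 𝒟.toCauchyDevelopment (Φ '' {x : U | τ₀ < x.1 0 ∧ ∀ i, Kerr.rPlus (M i) (a i) < Kerr.radius (a i) (poincareInv (Λ i (x.1 0)) (E4.ofTimeSpace (x.1 0) (ξ i (x.1 0))) x.1)}) ∧ ∀ t₁ : ℝ, τ₀ < t₁ → O \ Φ '' {x : U | t₁ < x.1 0 ∧ ∀ i, Kerr.rPlus (M i) (a i) < Kerr.radius (a i) (poincareInv (Λ i (x.1 0)) (E4.ofTimeSpace (x.1 0) (ξ i (x.1 0))) x.1)} ⊆ 𝒟.metric.causalPast 𝒟.timeOrientation (Φ '' {x : U | x.1 0 = t₁ ∧ ∀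 i, Kerr.rPlus (M i) (a i) < Kerr.radius (a i) (poincareInv (Λ i (x.1 0)) (E4.ofTimeSpace (x.1 0) (ξ i (x.1 0))) x.1)})) → N = 0 → (∃ τ₁ : ℝ, ∀ x y : U, (τ₁ < x.1 0 ∧ ∀ i, rin i < Kerr.radius (a i) (poincareInv (Λ i (x.1 0)) (E4.ofTimeSpace (x.1 0) (ξ i (x.1 0))) x.1)) → (τ₁ < y.1 0 ∧ ∀ i, rin i < Kerr.radius (a i) (poincareInv (Λ i (y.1 0)) (E4.ofTimeSpace (y.1 0) (ξ i (y.1 0))) y.1)) → Φ y ∈ 𝒟.metric.causalFuture 𝒟.timeOrientation {Φ x} → x.1 0 ≤ y.1 0) →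
    ∃ d : FinalStateDecomposition 𝒟.toSpacetime O 2, (∀ i, Kerr.IsSubextremal (d.mass i) (d.spin i)) ∧ O = Summit.FinalStateConjecture.exteriorOf 𝒟.toCauchyDevelopment d.charted ∧ Summit.FinalStateConjecture.HasExhaustiveCharts d ∧ Summit.FinalStateConjecture.IsFutureOriented d :=
  Summit.FinalStateConjecture.FinalStateConjecture.Theorems.SketchCleanExcision.stub_noHolesOnRegion

/-- **P2′ · RE-CHARTING ON THE GIVEN REGION** (the transfer, re-cut for E′). Under the antecedent block with `0 < N`, third-order slaving,
convergence of the painted velocities `v(Λᵢ(t)) → Vᵢ`, (T) eventual lab-time causality on the guaranteed region and (O) orthochronous painted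
frames, there is a `C²` final-state decomposition `d` OF THE LAB CHART'S OWN REGION `O` with sub-extremal holes, `O = exteriorOf 𝒟 d.charted`,
honest-radii exhaustion and future orientation. Route (all but the causal transfer landed): labels `Λᵢ^f := boost(Vᵢ)`, `cᵢ := 0`;
hole charts `Ψᵢ := Φ ∘ ψᵢ` from `Theorems.…StubRechart3G1.rechart_analytic_package` (smooth open embeddings into `Φ(late exterior)`,
truncated `C²` convergence to boosted Kerr for every spin, eventual disjointness; painted radius = chart radius, so horizon normalisation
is inherited from the exhaustion clause), flat chart `Φ` off `o(t)` tubes (Cesàro from velocity convergence, `…G1.rechart_norm_cesaro_le`),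
orientation inputs `Theorems.eventually_isFutureDirected_{flat,hole}Chart` (…StubRechart11Orient, from (O), (T) and `C⁰` closeness),
assembly ON `O` by `Theorems.exists_finalStateDecomposition_onRegion_of_rechart[']` (…StubRechart11Region: `O = exteriorOf C′` from the
TRANSFER at chart time `τ₀′+1` + push-up); the TRANSFER itself (every point of `O` is certified-late after `τ₁` or in `J⁻` of the
certified slab) from (T) as in seat 1's landed `a ≡ 0` theorem `Theorems.inertialRecession_spinZero_of_paintedVelocity` (…RechartSpinZero3;
white-hole exclusion now replaced by the hypothesis (O)) and, for `aᵢ ≠ 0`, the Carter/clock chain (…RechartCarterCertify,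
…RechartClockDictionary, …RechartTransfer3). Size XL (mostly landed). [O'Neill 1983 Ch. 14; arXiv:0811.0354 §5.1] -/
theorem stub_rechartOnRegion : ∀ (X : Type) [TopologicalSpace X] [ChartedSpace E3 X] [IsManifold (𝓡 3) ((⊤ : ℕ∞) : WithTop ℕ∞) X] [T2Space X] [SecondCountableTopology X] [ConnectedSpace X], ∀ D ∈ admissibleVacuumData X, ∀ 𝒟 : VacuumCauchyDevelopment D, 𝒟.IsMaximal → ∀ (N : ℕ) (M a rin : Fin N → ℝ) (Λ : Fin N → ℝ → lorentzGroup) (ξ : Fin N → ℝ → E3) (γ κ τ₀ : ℝ) (U : Opens E4) (Φ : U → 𝒟.carrier) (O : Set 𝒟.carrier), ((∀ i, Kerr.IsSubextremal (M i) (a i) ∧ Kerr.rMinus (M i) (a i) < rin i ∧ rin i < Kerr.rPlus (M i) (a i)) ∧ (∀ i t, |((Λ i t : E4 ≃L[ℝ] E4) (E4.basisVector 0)) 0| ≤ γ) ∧ (∀ i, ContDiff ℝ ((⊤ : ℕ∞) : WithTop ℕ∞) (ξ i) ∧ ContDiff ℝ ((⊤ : ℕ∞) : WithTop ℕ∞)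 (fun t ↦ ((Λ i t : E4 ≃L[ℝ] E4) : E4 →L[ℝ] E4))) ∧ (∀ i j, i ≠ j → Tendsto (fun t ↦ ‖ξ i t - ξ j t‖) atTop atTop) ∧ (0 < κ ∧ κ < 1 ∧ ∀ i, ∀ᶠ t in atTop, ‖ξ i t‖ ≤ κ ^ 2 * t) ∧ ({x : E4 | τ₀ < x 0 ∧ ∀ i, rin i < Kerr.radius (a i) (poincareInv (Λ i (x 0)) (E4.ofTimeSpace (x 0) (ξ i (x 0))) x)} ⊆ (U : Set E4)) ∧ let B : ModelBackground := ⟨U, fun x ↦ Minkowski.bilin + ∑ i, (boostedKerrBilin (Λ i (x 0)) (E4.ofTimeSpace (x 0) (ξ i (x 0))) (M i) (a i) x - Minkowski.bilin), fun x ↦ x 0, E4.spatialNorm⟩; ContMDiff 𝓘(ℝ, E4) (𝓡 4) ((⊤ : ℕ∞) : WithTop ℕ∞) Φ ∧ Topology.IsOpenEmbedding ((B.lateRegion τ₀).restrict Φ) ∧ Φ '' {x : U | τ₀ < x.1 0 ∧ ∀ i, Kerr.rPlus (M i) (a i) < Kerr.radius (a i) (poincareInv (Λ i (x.1 0)) (E4.ofTimeSpace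 (x.1 0) (ξ i (x.1 0))) x.1)} ⊆ O ∧ Tendsto (fun t ↦ 𝒟.toSpacetime.deviationCk B Φ 3 t) atTop (𝓝 0) ∧ Tendsto (fun t : ℝ ↦ ⨆ x ∈ {x : U | x.1 0 = t ∧ E4.spatialNorm x.1 ≤ κ * t}, ⨆ (m : ℕ) (_ : m ≤ 3), ENNReal.ofReal (1 + √(√((⨅ i, ‖E4.spatial x.1 - ξ i t‖) ^ 7))) * ‖iteratedFDeriv ℝ m (𝒟.toSpacetime.deviationExtend B Φ) x.1‖ₑ) atTop (𝓝 0) ∧ O = Summit.FinalStateConjecture.exteriorOf 𝒟.toCauchyDevelopment (Φ '' {x : U | τ₀ < x.1 0 ∧ ∀ i, Kerr.rPlus (M i) (a i) < Kerr.radius (a i) (poincareInv (Λ i (x.1 0)) (E4.ofTimeSpace (x.1 0) (ξ i (x.1 0))) x.1)}) ∧ ∀ t₁ : ℝ, τ₀ < t₁ → O \ Φ '' {x : U | t₁ < x.1 0 ∧ ∀ i, Kerr.rPlus (M i) (a i) < Kerr.radius (a i) (poincareInv (Λ i (x.1 0)) (E4.ofTimeSpace (x.1 0) (ξ i (x.1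 0))) x.1)} ⊆ 𝒟.metric.causalPast 𝒟.timeOrientation (Φ '' {x : U | x.1 0 = t₁ ∧ ∀ i, Kerr.rPlus (M i) (a i) < Kerr.radius (a i) (poincareInv (Λ i (x.1 0)) (E4.ofTimeSpace (x.1 0) (ξ i (x.1 0))) x.1)})) → 0 < N →
    (∀ i : Fin N, (∀ m : ℕ, 1 ≤ m → m ≤ 3 → Tendsto (fun t ↦ iteratedDeriv m (fun s ↦ (((Λ i s : lorentzGroup) : E4 ≃L[ℝ] E4) (E4.basisVector 0))) t) atTop (𝓝 0)) ∧ (∀ m : ℕ, m ≤ 2 → Tendsto (fun t ↦ iteratedDeriv m (fun s ↦ deriv (ξ i) s - (((((Λ i s : lorentzGroup) : E4 ≃L[ℝ] E4) (E4.basisVector 0)) 0)⁻¹ • E4.spatial (((Λ i s : lorentzGroup) : E4 ≃L[ℝ] E4) (E4.basisVector 0)))) t) atTop (𝓝 0)) ∧ (a i ≠ 0 → ∀ m : ℕ, 1 ≤ m → m ≤ 3 → Tendsto (fun t ↦ iteratedDeriv m (fun s ↦ (((Λ i s : lorentzGroup) : E4 ≃L[ℝ] E4) (E4.basisVector 3)))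 t) atTop (𝓝 0))) →
    (∀ i : Fin N, ∃ V : E3, Tendsto (fun t ↦ ((((Λ i t : lorentzGroup) : E4 ≃L[ℝ] E4) (E4.basisVector 0)) 0)⁻¹ • E4.spatial (((Λ i t : lorentzGroup) : E4 ≃L[ℝ] E4) (E4.basisVector 0))) atTop (𝓝 V)) →
    (∃ τ₁ : ℝ, ∀ x y : U, (τ₁ < x.1 0 ∧ ∀ i, rin i < Kerr.radius (a i) (poincareInv (Λ i (x.1 0)) (E4.ofTimeSpace (x.1 0) (ξ i (x.1 0))) x.1)) → (τ₁ < y.1 0 ∧ ∀ i, rin i < Kerr.radius (a i) (poincareInv (Λ i (y.1 0)) (E4.ofTimeSpace (y.1 0) (ξ i (y.1 0))) y.1)) → Φ y ∈ 𝒟.metric.causalFuture 𝒟.timeOrientation {Φ x} → x.1 0 ≤ y.1 0) →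
    (∀ (i : Fin N) (t : ℝ), 0 < (((Λ i t : lorentzGroup) : E4 ≃L[ℝ] E4) (E4.basisVector 0)) 0) →
    ∃ d : FinalStateDecomposition 𝒟.toSpacetime O 2, (∀ i, Kerr.IsSubextremal (d.mass i) (d.spin i)) ∧ O = Summit.FinalStateConjecture.exteriorOf 𝒟.toCauchyDevelopment d.charted ∧ Summit.FinalStateConjecture.HasExhaustiveCharts d ∧ Summit.FinalStateConjecture.IsFutureOriented d :=
  Summit.FinalStateConjecture.FinalStateConjecture.Theorems.stub_rechartOnRegion

/-! ## The composition (kernel-checked; concludes the crux BY NAME) -/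

/-- `InertialRecession` (E′) from the stubs: destructure the antecedent into the old twelve-clause block `hL` and (T), (O), (R), (QS);
`N = 0` is `stub_noHolesOnRegion`; for `0 < N`: slaving ⇒ (pseudotensor bound (proved) ⇒ window law (landed)) + identification (proved) +
clean excision ⇒ integrated cluster balance ⇒ increment oracle ⇒ every painted velocity converges (landed `tendsto_velocity_of_oracle`) ⇒
re-charting on the given region; (R) passes through. Pure logic; every `sorry` lives in a `stub_*`. -/
theorem InertialRecession_of : InertialRecession := by
  intro X _ _ _ _ _ _ D hD 𝒟 h𝒟 hyp
  obtain ⟨N, M, a, rin, Λ, ξ, γ, κ, τ₀, U, Φ, O, h1, h2, h3, h4, h5, h6, hB⟩ := hyp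
  obtain ⟨h7, h8, h9, h10, h11, h12, h13, hT, hO, hR, hQS⟩ := hB
  have hL : ((∀ i, Kerr.IsSubextremal (M i) (a i) ∧ Kerr.rMinus (M i) (a i) < rin i ∧ rin i < Kerr.rPlus (M i) (a i)) ∧ (∀ i t, |((Λ i t : E4 ≃L[ℝ] E4) (E4.basisVector 0)) 0| ≤ γ) ∧ (∀ i, ContDiff ℝ ((⊤ : ℕ∞) : WithTop ℕ∞) (ξ i) ∧ ContDiff ℝ ((⊤ : ℕ∞) : WithTop ℕ∞) (fun t ↦ ((Λ i t : E4 ≃L[ℝ] E4) : E4 →L[ℝ] E4))) ∧ (∀ i j, i ≠ j → Tendsto (fun t ↦ ‖ξ i t - ξ j t‖) atTop atTop) ∧ (0 < κ ∧ κ < 1 ∧ ∀ i, ∀ᶠ t in atTop, ‖ξ i t‖ ≤ κ ^ 2 * t) ∧ ({x : E4 | τ₀ < x 0 ∧ ∀ i, rin i < Kerr.radius (a i) (poincareInv (Λ i (x 0)) (E4.ofTimeSpace (x 0) (ξ i (x 0))) x)} ⊆ (U : Set E4)) ∧ let B : ModelBackground := ⟨U, fun x ↦ Minkowski.bilin + ∑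 i, (boostedKerrBilin (Λ i (x 0)) (E4.ofTimeSpace (x 0) (ξ i (x 0))) (M i) (a i) x - Minkowski.bilin), fun x ↦ x 0, E4.spatialNorm⟩; ContMDiff 𝓘(ℝ, E4) (𝓡 4) ((⊤ : ℕ∞) : WithTop ℕ∞) Φ ∧ Topology.IsOpenEmbedding ((B.lateRegion τ₀).restrict Φ) ∧ Φ '' {x : U | τ₀ < x.1 0 ∧ ∀ i, Kerr.rPlus (M i) (a i) < Kerr.radius (a i) (poincareInv (Λ i (x.1 0)) (E4.ofTimeSpace (x.1 0) (ξ i (x.1 0))) x.1)} ⊆ O ∧ Tendsto (fun t ↦ 𝒟.toSpacetime.deviationCk B Φ 3 t) atTop (𝓝 0) ∧ Tendsto (fun t : ℝ ↦ ⨆ x ∈ {x : U | x.1 0 = t ∧ E4.spatialNorm x.1 ≤ κ * t}, ⨆ (m : ℕ) (_ : m ≤ 3), ENNReal.ofReal (1 + √(√((⨅ i, ‖E4.spatial x.1 - ξ i t‖) ^ 7))) * ‖iteratedFDeriv ℝ m (𝒟.toSpacetime.deviationExtend B Φ) x.1‖ₑ) atTop (𝓝 0) ∧ O = Summit.FinalStateConjecture.exteriorOf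 𝒟.toCauchyDevelopment (Φ '' {x : U | τ₀ < x.1 0 ∧ ∀ i, Kerr.rPlus (M i) (a i) < Kerr.radius (a i) (poincareInv (Λ i (x.1 0)) (E4.ofTimeSpace (x.1 0) (ξ i (x.1 0))) x.1)}) ∧ ∀ t₁ : ℝ, τ₀ < t₁ → O \ Φ '' {x : U | t₁ < x.1 0 ∧ ∀ i, Kerr.rPlus (M i) (a i) < Kerr.radius (a i) (poincareInv (Λ i (x.1 0)) (E4.ofTimeSpace (x.1 0) (ξ i (x.1 0))) x.1)} ⊆ 𝒟.metric.causalPast 𝒟.timeOrientation (Φ '' {x : U | x.1 0 = t₁ ∧ ∀ i, Kerr.rPlus (M i) (a i) < Kerr.radius (a i) (poincareInv (Λ i (x.1 0)) (E4.ofTimeSpace (x.1 0) (ξ i (x.1 0))) x.1)})) :=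
    ⟨h1, h2, h3, h4, h5, h6, h7, h8, h9, h10, h11, h12, h13⟩
  -- no hole: the dispersive case on the given region
  rcases Nat.eq_zero_or_pos N with hN0 | hN
  · obtain ⟨d, hsub, hOe, hexh, hfo⟩ := stub_noHolesOnRegion X D hD 𝒟 h𝒟 N M a rin Λ ξ γ κ τ₀ U Φ O hL hN0 hT
    exact ⟨O, d, hsub, hOe, hR, hexh, hfo⟩
  obtain ⟨hS, hcont, hk⟩ := stub_slaving X D hD 𝒟 h𝒟 N M a rin Λ ξ γ κ τ₀ U Φ O hL
  have hW := Summit.FinalStateConjecture.FinalStateConjecture.Theorems.SublinearIsFree.ChargeModel.windowLaw stub_pseudotensorBound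
    X D hD 𝒟 h𝒟 N M a rin Λ ξ γ κ τ₀ U Φ O hL hN hS hQS
  have hI := Summit.FinalStateConjecture.FinalStateConjecture.Theorems.SublinearIsFree.ChargeModel.cleanWindowCharges_identification
    stub_pseudotensorBound X D hD 𝒟 h𝒟 N M a rin Λ ξ γ κ τ₀ U Φ O hL hN hS hQS
  have hE := stub_cleanExcision stub_pseudotensorBound X D hD 𝒟 h𝒟 N M a rin Λ ξ γ κ τ₀ U Φ O hL hN hS hQS
  -- kinematic clauses of the antecedent consumed by the endgame
  have hM : ∀ i, 0 < M i := fun i ↦ (abs_nonneg (a i)).trans_lt (hL.1 i).1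
  have hκ : 0 < κ ∧ κ < 1 ∧ ∀ i, ∀ᶠ t in atTop, ‖ξ i t‖ ≤ κ ^ 2 * t := hL.2.2.2.2.1
  have hsep : ∀ i j, i ≠ j → Tendsto (fun t ↦ ‖ξ i t - ξ j t‖) atTop atTop := hL.2.2.2.1
  have hsmooth : ∀ i, ContDiff ℝ ((⊤ : ℕ∞) : WithTop ℕ∞) (ξ i) := fun i ↦ (hL.2.2.1 i).1
  have hmis : ∀ i, Tendsto (fun t ↦ deriv (ξ i) t -
      ((((Λ i t : lorentzGroup) : E4 ≃L[ℝ] E4) (E4.basisVector 0)) 0)⁻¹ •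
        E4.spatial (((Λ i t : lorentzGroup) : E4 ≃L[ℝ] E4) (E4.basisVector 0))) atTop (𝓝 0) := fun i ↦ by
    simpa using (hS i).2.1 0 (Nat.zero_le 2)
  obtain ⟨k, hk0, hk1, hkb⟩ := hk
  have hCB := stub_integratedClusterBalance N M ξ _ κ _ hM hκ.1 hκ.2.1 hsmooth hκ.2.2 hsep hcont
    ⟨k, hk0, hk1, fun i t ↦ hkb i t⟩ hmis hW hI hE
  obtain ⟨Q, hQ400, hOR⟩ := stub_oracleOfClusterBalance N M ξ _ κ hM hκ.1 hκ.2.1 hsmooth hκ.2.2 hsep hcont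
    ⟨k, hk0, hk1, fun i t ↦ hkb i t⟩ hmis hCB
  -- every painted velocity converges (the abstract endgame modulo the oracle, every `N`)
  have hv := Summit.FinalStateConjecture.FinalStateConjecture.Theorems.SublinearIsFree.Oracle.tendsto_velocity_of_oracle M ξ _ Q hM hQ400
    hcont ⟨k, hk0, hk1, fun i t ↦ hkb i t⟩ hmis hOR
  obtain ⟨d, hsub, hOe, hexh, hfo⟩ := stub_rechartOnRegion X D hD 𝒟 h𝒟 N M a rin Λ ξ γ κ τ₀ U Φ O hL hN hS hv hT hO
  exact ⟨O, d, hsub, hOe, hR, hexh, hfo⟩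

end Summit.FinalStateConjecture.FinalStateConjecture.Cruxes.InertialRecession.SketchCleanExcision

end
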